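import Literature.AlgebraicGeometry.Motives.HodgeLieSymplecticBlocksProduct
import Literature.AlgebraicGeometry.Motives.HodgeThetaAnnihilatorLieAlgebra
import HarnessLib

/-!
# Rational Lie algebras containing the Hodge operator on a weight-one Hodge structure with FOUR-dimensional real
# eigenblocks: `𝔤_ℂ = ⊕_i 𝔰𝔭(T_i) = 𝔰𝔭_E(V, ψ)_ℂ` for EVERY admissible `𝔤`, and Theorem L — rational tensors killed by
# `Θ` are killed by `⊕_i 𝔰𝔭(T_i)` (Moonen–Zarhin 1995 Type I(2) «`Hg = R_{F/ℚ} Sp_{4,F}`»; 1999 §3 (3.1), Lemma (3.4);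
# Hazama 1983 §3; Deligne LNM 900 I §3 minimality)

Family `hodge`, layer `Literature/AlgebraicGeometry/Motives` (abstract polarizable `ℚ`-Hodge structures; no geometry).
THEOREMS ONLY (no definition, no named fact; D-0026); UNCONDITIONAL; no step towards a summit statement. Written for the
cell `pub-hodge-ring2` (HONEST FRAMING: research route conditional on HC_CM; not a corollary; Q11.4-sentence-2 already
refuted in dim ≥ 3), Literature lane gen 70, programme R47-B «the type I(2) row of Moonen–Zarhin 1995» (real multiplication
of RELATIVE DIMENSION TWO: `End⁰X = F` totally real, `dim X = 2[F:ℚ]`), THE LIE STEP for an ARBITRARY admissible algebra.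

THE TREE ALREADY HAS (cell `pub-hodgecm2`, seat `b27`): `HodgeLieSymplecticBlocksRankFour` (S1: `Lie Hg ⊗ ℂ` restricts ONTO
`𝔰𝔭(T_i)` on every four-dimensional real eigenblock), `HodgeLieSymplecticBlocksSemisimple` (S3: block data, ideals on a
block, semisimplicity of `Lie Hg ⊗ ℂ`), `HodgeLieSymplecticBlocksProduct` (S4: the Goursat step, supported lifts — for
`𝔤 = Lie Hg ⊗ ℂ` ONLY). For the Hodge-class theorem «`B•(Xⁿ) = D•(Xⁿ)`» (Ribet/Hazama mechanism through the invariant theory of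
`∏ Sp(T_i)`, in the tree's WORD MODEL of `HodgeThetaAnnihilatorLieAlgebra`) one needs the same conclusion for the RATIONAL
ANNIHILATOR Lie algebra `𝔞(q)` of a rational Hodge tensor `q` — an «admissible» algebra: a bracket-closed `ℚ`-subspace
`𝔤 ⊆ End_ℚ(V)` of `ψ`-skew operators commuting with `E = End_Hdg(V)` whose complex span `𝔤_ℂ = spanC 𝔤` contains the Hodge
operator `Θ` (Deligne's principle: the group fixing a Hodge tensor is defined over `ℚ` and contains `μ(𝔾_m)`; the tree's
two-dimensional-block version is `HodgeThetaSubalgebraRealPlacesSl2`, `ThetaSubalgebra.mem_spanC_of_mapsTo_of_skew`). THIS FILE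
runs S1–S4 for every admissible `𝔤`; the only changes to the cited proofs are: irreducibility of the blocks and complete
reducibility of `V_ℂ` come from the second Hodge–Riemann relation through `U† = {y : ψ_ℂ(y, conj U) = 0}` (the device of
`SymplecticTheta.eq_bot_or_top_of_stable`) instead of the Hodge-form adjoint, the commutant of `𝔤_ℂ` lies in `E ⊗ ℂ` by
descent (`ThetaSubalgebra.mem_span_endAlg_of_forall_commute`), and semisimplicity of `𝔤_ℂ` comes from Lie's theorem
(`Literature.Algebra.Lie.hasCentralRadical_of_complementedLattice`) plus «`𝔰𝔭₄` has trivial centre» instead of Deligne I 3.6.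

SETTING. `H` an effective polarized `ℚ`-Hodge structure of weight `1` on a finite-dimensional `V`; `ψ` a polarization for
which every Hodge endomorphism is `ψ`-self-adjoint (`hself`; `E` a totally real field); `σ_i : E → ℂ` REAL characters whose
eigenblocks `T_i = H.eigenBlock (σ i)` form an internal direct sum `V_ℂ = ⊕_i T_i` and are FOUR-dimensional; `Θ` the Hodge
operator (`= 2p - 1` on `V^{p,1-p}`); `𝔤` admissible (`hbr`, `hcomm`, `hskew`, `hΘ𝔤 : Θ ∈ spanC 𝔤`).

* §1 `SpBlocksTheta.exists_isCompl_of_stable` — COMPLETE REDUCIBILITY: a `𝔤`-stable `U ⊆ V_ℂ` has the `𝔤`-stable complement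
  `U†`, and the projector onto `U` commutes with `𝔤` (hence lies in `E ⊗ ℂ`); `SpBlocksTheta.eq_bot_or_eq_block_of_stable` —
  a `𝔤`-stable `U ⊆ T_i` is `0` or `T_i` (Zarhin 1983 §2: «`T_σ` is an irreducible `Lie(Hdg)_ℂ`-module», for any admissible `𝔤`).
* §2 **`SpBlocksTheta.exists_mem_spanC_restrict_eq`** — `𝔤_ℂ` restricts ONTO `𝔰𝔭(T_i, ψ_ℂ|_{T_i})` on every block (the core
  theorem `SymplecticTheta.core_of_irreducible` for `T = ±Θ|_{T_i}`; Moonen–Zarhin 1995 Type I(2), 1999 (2.2)).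
* §3 `SpBlocksTheta.restrict_ideal_dichotomy` (an ideal of `𝔤_ℂ` kills `T_j` or restricts onto `𝔰𝔭(T_j)`: «`𝔰𝔭₄` is simple»,
  `SymplecticIdeal.mem_of_ne_bot`), `SpBlocksTheta.apply_eq_zero_of_forall_commute` («trivial centre»),
  `SpBlocksTheta.exists_lieSubalgebra_eq_spanC`, `SpBlocksTheta.complementedLattice_lieSubmodule`,
  **`SpBlocksTheta.isSemisimple`** (`𝔤_ℂ` is a semisimple Lie algebra: faithful completely reducible ⟹ central radical
  (Lie's theorem), centre `= 0` block by block, Cartan's criterion).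
* §4 `SpBlocksTheta.exists_complement_ideal` (Boolean algebra of ideals), `SpBlocksTheta.eq_zero_of_equivariant` (no
  non-zero `𝔤`-equivariant `T_i → T_j`, `i ≠ j`: commutant descent), **`SpBlocksTheta.exists_mem_spanC_supported`** — THE
  GOURSAT STEP: for every `i` and every skew `g` on `T_i` there is `Y ∈ 𝔤_ℂ` with `Y|_{T_i} = g`, `Y|_{T_j} = 0` (`j ≠ i`)
  (Moonen–Zarhin (3.1)/(3.4): the standard representation is the only length-one representation of `𝔰𝔭`,
  `SymplecticWitness.exists_equivariant_ne_zero`).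
* §5 **`SpBlocksTheta.mem_spanC_of_mapsTo_of_skew`** — `𝔤_ℂ ∋ Y` for EVERY block-preserving `ψ_ℂ`-skew `Y`
  (`𝔤_ℂ = ⊕_i 𝔰𝔭(T_i) = 𝔰𝔭_E(V,ψ)_ℂ`); `SpBlocksTheta.hodgeLieC_le_spanC`, **`SpBlocksTheta.eq_hodgeLie`** (`𝔤 = Lie Hg(H)`:
  UNIQUENESS of the admissible algebra, Deligne's minimality in Lie form); and THEOREM L
  **`SpBlocksTheta.wordDerAt_eq_zero_of_mapsTo_of_skew`** — a RATIONAL coefficient tensor killed (slice by slice) by the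
  matrix of `Θ` is killed by the matrix of every block-preserving `ψ_ℂ`-skew operator (the annihilator algebra `annLie`
  is admissible, `mem_spanC_annLie`) — the Lie input of «`B•(Xⁿ) = D•(Xⁿ)` for abelian varieties with `End⁰X` a totally
  real field of degree `dim X / 2`» (Moonen–Zarhin 1999 Thm. 0.1 (4) for fourfolds of type I(2); Hazama 1983 Thm. (1.1) /
  Murty for the mechanism), whose geometric half is the sequel.

## References

* [MoonenZarhin1995Duke] B. Moonen, Yu. G. Zarhin, *Hodge classes and Tate classes on simple abelian fourfolds*, Duke Math.
  J. 77 (1995) 553–581, Type I(2): «`Hg = R_{F/ℚ} Sp_F(V, ψ)`». [cite: MoonenZarhin1995Duke, Type I(2)]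
* [MoonenZarhin1999LowDim] B. Moonen, Yu. G. Zarhin, Math. Ann. 315 (1999) 711–733 (held `paper:arxiv-math_9901113`),
  §2 (2.2), Thm. 0.1 (4) («`Hg(X) = Sp_D(V,φ)` and `B•(Xⁿ) = D•(Xⁿ)`»), §3 (3.1), Lemma (3.3), Lemma (3.4).
  [cite: MoonenZarhin1999LowDim, §3 (3.1) and Lemma (3.4)]
* [Hazama1983] F. Hazama, Tôhoku Math. J. 35 (1983) 303–308, §3 pp. 305–306 (blocks, Goursat over the places).
  [cite: Hazama1983, §3 (pp. 305–306)]
* [Deligne1982HodgeCycles] P. Deligne, LNM 900 (1982), I §3 Prop. 3.4 (minimality, descent), Prop. 3.6 (reductivity).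
  [cite: Deligne1982HodgeCycles, I §3 Prop. 3.4]
* [Zarhin1983HodgeGroupsK3] Yu. G. Zarhin, J. reine angew. Math. 341 (1983), §2. [cite: Zarhin1983HodgeGroupsK3, §2]
* [Humphreys1972] J. E. Humphreys, GTM 9, §5.2 (semisimple = sum of simple ideals), §19.1 (completely reducible ⟹
  reductive). [cite: Humphreys1972, §5.2]
* [GoodmanWallachGTM255] R. Goodman, N. Wallach, GTM 255, §2.1.2 (Siegel form of `𝔰𝔭`). [cite: GoodmanWallachGTM255, §2.1.2]
-/

noncomputable section

open scoped TensorProduct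

namespace Literature.AlgebraicGeometry.Motives

namespace HodgeStructure

universe u

variable {V : Type u} [AddCommGroup V] [Module ℚ V] [Module.Finite ℚ V] [HodgeTensorFacts.{u, u}] {n : ℤ}
variable {ι : Type*} [DecidableEq ι]

/-! ### §0 Admissible algebras preserve the blocks and are skew after complexification -/

omit [Module.Finite ℚ V] [HodgeTensorFacts.{u, u}] [DecidableEq ι] in
/-- Elements of `𝔤_ℂ` preserve every eigenblock of `E` when `𝔤` commutes with `E`. [cite: Zarhin1983HodgeGroupsK3, §2] -/
theorem SpBlocksTheta.apply_mem_eigenBlock (H : HodgeStructure V n) (σ : ι → (H.endAlg →+* ℂ))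
    {𝔤 : Submodule ℚ (Module.End ℚ V)}
    (hcomm : ∀ X ∈ 𝔤, ∀ a : H.endAlg, X * (a : Module.End ℚ V) = (a : Module.End ℚ V) * X)
    {Y : Module.End ℂ (ℂ ⊗[ℚ] V)} (hY : Y ∈ spanC 𝔤) (i : ι) {x : ℂ ⊗[ℚ] V} (hx : x ∈ H.eigenBlock (σ i)) :
    Y x ∈ H.eigenBlock (σ i) :=
  mapsTo_of_mem_spanC (T := H.eigenBlock (σ i))
    (fun X hX => ThetaSubalgebra.mapsTo_baseChange_of_commute H σ (hcomm X hX) i) hY hx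

/-! ### §1 Complete reducibility of `V_ℂ` and irreducibility of the blocks under an admissible algebra -/

omit [HodgeTensorFacts.{u, u}] in
/-- **Complete reducibility under an admissible algebra.** Let `H` be effective polarized of weight one and `𝔤 ⊆ End_ℚ(V)`
a `ℚ`-subspace of `ψ`-skew operators whose complex span contains a Hodge operator `Θ`. Every subspace `U ⊆ V_ℂ` stable
under the `X_ℂ`, `X ∈ 𝔤`, has the stable complement `U† = {y : ψ_ℂ(y, conj U) = 0}` (the `X_ℂ` are real and skew; `U` is
`Θ`-graded, so `U ∩ U† = 0` by the second Hodge–Riemann relation, and `dim U† ≥ dim V_ℂ - dim U`), and the projector onto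
`U` along `U†` commutes with every `X_ℂ`. (The device of `SymplecticTheta.eq_bot_or_top_of_stable`; Deligne I 3.6
«`MT` est réductif» for an arbitrary admissible algebra.) [cite: Deligne1982HodgeCycles, I §3 Prop. 3.4]
[cite: Zarhin1983HodgeGroupsK3, §2] -/
theorem SpBlocksTheta.exists_isCompl_of_stable (H : HodgeStructure V n) (hn : n = 1) (heff : H.IsEffective)
    (ψ : H.Polarization) (𝔤 : Submodule ℚ (Module.End ℚ V)) {Θ : Module.End ℂ (ℂ ⊗[ℚ] V)}
    (hΘ : ∀ p, ∀ x ∈ H.piece p (n - p), Θ x = ((2 * p - n : ℤ) : ℂ) • x) (hΘ𝔤 : Θ ∈ spanC 𝔤)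
    (hskew : ∀ X ∈ 𝔤, ∀ v w, ψ.form (X v) w + ψ.form v (X w) = 0)
    {U : Submodule ℂ (ℂ ⊗[ℚ] V)} (hU : ∀ X ∈ 𝔤, ∀ u ∈ U, X.baseChange ℂ u ∈ U) :
    ∃ (U' : Submodule ℂ (ℂ ⊗[ℚ] V)) (hc : IsCompl U U'), (∀ X ∈ 𝔤, ∀ y ∈ U', X.baseChange ℂ y ∈ U') ∧
      ∀ X ∈ 𝔤, U.projection U' hc * X.baseChange ℂ = X.baseChange ℂ * U.projection U' hc := by
  subst hn
  classical
  set ψC := ψ.form.baseChange ℂ with hψC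
  obtain ⟨hP, hQ, -, -, -⟩ := UnitaryTheta.theta_facts H rfl heff hΘ
  have hPQ : ∀ v, (2 : ℂ)⁻¹ • (v + Θ v) + (2 : ℂ)⁻¹ • (v - Θ v) = v := fun v => by module
  have hXskew : ∀ X ∈ 𝔤, ∀ x y, ψC (X.baseChange ℂ x) y + ψC x (X.baseChange ℂ y) = 0 :=
    fun X hX => ThetaSubalgebra.formBaseChange_add_eq_zero_of_skew ψ (hskew X hX)
  have hgraded : ∀ T : Submodule ℂ (ℂ ⊗[ℚ] V), (∀ X ∈ 𝔤, ∀ u ∈ T, X.baseChange ℂ u ∈ T) →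
      ∀ u ∈ T, (2 : ℂ)⁻¹ • (u + Θ u) ∈ T ∧ (2 : ℂ)⁻¹ • (u - Θ u) ∈ T := by
    intro T hT u hu
    have hΘu : Θ u ∈ T := mapsTo_of_mem_spanC (T := T) (fun X hX => fun u hu => hT X hX u hu) hΘ𝔤 hu
    exact ⟨Submodule.smul_mem _ _ (Submodule.add_mem _ hu hΘu),
      Submodule.smul_mem _ _ (Submodule.sub_mem _ hu hΘu)⟩
  -- `U† = {y : ψ_ℂ(y, conj U) = 0}`
  set Ud : Submodule ℂ (ℂ ⊗[ℚ] V) := ⨅ u : U, LinearMap.ker (ψC.flip (conj (u : ℂ ⊗[ℚ] V))) with hUddef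
  have hmemUd : ∀ y, y ∈ Ud ↔ ∀ u ∈ U, ψC y (conj u) = 0 := fun y => by
    simp only [hUddef, Submodule.mem_iInf, LinearMap.mem_ker, Subtype.forall]
    exact Iff.rfl
  have hXUd : ∀ X ∈ 𝔤, ∀ y ∈ Ud, X.baseChange ℂ y ∈ Ud := by
    intro X hX y hy
    rw [hmemUd] at hy ⊢
    intro u hu
    have h := hXskew X hX y (conj u)
    rwa [← conj_baseChange, hy _ (hU X hX u hu), add_zero] at h
  -- `U ∩ U† = 0`
  have hUUd : ∀ u ∈ U, u ∈ Ud → u = 0 := by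
    intro u hu hud
    have key : ∀ z ∈ U, z ∈ Ud → ∀ p q : ℤ, p + q = 1 → z ∈ H.piece p q → z = 0 := by
      intro z hz hzd p q hpq hzpq
      by_contra hz0
      exact ψ.form_conj_ne_zero hpq hzpq hz0 (((hmemUd z).1 hzd) z hz)
    have h1 := key _ (hgraded U hU u hu).1 (hgraded Ud hXUd u hud).1 1 0 (by norm_num) (hP u)
    have h2 := key _ (hgraded U hU u hu).2 (hgraded Ud hXUd u hud).2 0 1 (by norm_num) (hQ u)
    rw [← hPQ u, h1, h2, add_zero]
  -- `dim V_ℂ ≤ dim U + dim U†`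
  have hdim : Module.finrank ℂ (ℂ ⊗[ℚ] V) ≤ Module.finrank ℂ U + Module.finrank ℂ Ud := by
    set b := Module.finBasis ℂ U with hbdef
    set f : (ℂ ⊗[ℚ] V) →ₗ[ℂ] (Fin (Module.finrank ℂ U) → ℂ) :=
      LinearMap.pi fun i => ψC.flip (conj (b i : ℂ ⊗[ℚ] V)) with hfdef
    have hf : ∀ w i, f w i = ψC w (conj (b i : ℂ ⊗[ℚ] V)) := fun w i => rfl
    have hker : LinearMap.ker f ≤ Ud := by
      intro w hw
      rw [LinearMap.mem_ker] at hw
      rw [hmemUd]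
      intro u hu
      have hu' : u = ∑ i, b.repr ⟨u, hu⟩ i • (b i : ℂ ⊗[ℚ] V) := by
        have h := congrArg Subtype.val (b.sum_repr ⟨u, hu⟩).symm
        simpa only [Submodule.coe_sum, Submodule.coe_smul] using h
      rw [hu', map_sum, map_sum]
      refine Finset.sum_eq_zero fun i _ => ?_
      have hi := congrFun hw i
      rw [Pi.zero_apply, hf] at hi
      rw [conj_smul, map_smul, smul_eq_mul, hi, mul_zero]
    have h1 := LinearMap.finrank_range_add_finrank_ker f
    have h2 : Module.finrank ℂ (LinearMap.range f) ≤ Module.finrank ℂ U :=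
      (Submodule.finrank_le _).trans (Module.finrank_fin_fun ℂ).le
    have h3 : Module.finrank ℂ (LinearMap.ker f) ≤ Module.finrank ℂ Ud := Submodule.finrank_mono hker
    omega
  -- `V_ℂ = U ⊕ U†`
  have h0 : U ⊓ Ud = ⊥ := by
    rw [eq_bot_iff]
    intro u hu
    rw [Submodule.mem_bot]
    exact hUUd u hu.1 hu.2
  have hsup : U ⊔ Ud = ⊤ := by
    refine Submodule.eq_top_of_finrank_eq ?_
    have h := Submodule.finrank_sup_add_finrank_inf_eq U Ud
    rw [h0, finrank_bot, add_zero] at h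
    have h' := Submodule.finrank_le (U ⊔ Ud)
    omega
  have hc : IsCompl U Ud := ⟨disjoint_iff.2 h0, codisjoint_iff.2 hsup⟩
  refine ⟨Ud, hc, hXUd, fun X hX => ?_⟩
  -- the projector onto `U` commutes with `𝔤`
  refine LinearMap.ext fun x => ?_
  rw [Module.End.mul_apply, Module.End.mul_apply]
  have hx : x = U.projection Ud hc x + (x - U.projection Ud hc x) := by abel
  have h1 : U.projection Ud hc x ∈ U := Submodule.projection_apply_mem hc x
  have h2 : X.baseChange ℂ (x - U.projection Ud hc x) ∈ Ud := hXUd X hX _ (Submodule.sub_projection_mem hc x)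
  conv_lhs => rw [hx]
  rw [map_add, map_add, Submodule.projection_apply_of_mem_left hc (hU X hX _ h1),
    (Submodule.projection_apply_eq_zero_iff hc).2 h2, add_zero]

omit [HodgeTensorFacts.{u, u}] in
/-- **Irreducibility of the eigenblocks under an admissible algebra.** With `H`, `ψ`, `𝔤`, `Θ` as above and `τ` a character
of `E = End_Hdg(V)`: a subspace `U` of the eigenblock `T_τ` stable under the `X_ℂ`, `X ∈ 𝔤`, is `0` or `T_τ` — the
projector onto `U` along `U†` commutes with `𝔤`, hence lies in `E ⊗ ℂ` (commutant descent,
`ThetaSubalgebra.mem_span_endAlg_of_forall_commute`), hence is a scalar on `T_τ`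
(`exists_forall_apply_eq_smul_of_mem_span_endAlg`). Zarhin 1983 §2 «`T_σ` is an irreducible `Lie(Hdg T)_ℂ`-module», here
for any admissible algebra. [cite: Zarhin1983HodgeGroupsK3, §2] [cite: Deligne1982HodgeCycles, I §3 Prop. 3.4] -/
theorem SpBlocksTheta.eq_bot_or_eq_block_of_stable (H : HodgeStructure V n) (hn : n = 1) (heff : H.IsEffective)
    (ψ : H.Polarization) (𝔤 : Submodule ℚ (Module.End ℚ V)) {Θ : Module.End ℂ (ℂ ⊗[ℚ] V)}
    (hΘ : ∀ p, ∀ x ∈ H.piece p (n - p), Θ x = ((2 * p - n : ℤ) : ℂ) • x) (hΘ𝔤 : Θ ∈ spanC 𝔤)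
    (hskew : ∀ X ∈ 𝔤, ∀ v w, ψ.form (X v) w + ψ.form v (X w) = 0) (τ : H.endAlg →+* ℂ)
    {U : Submodule ℂ (ℂ ⊗[ℚ] V)} (hUT : U ≤ H.eigenBlock τ) (hU : ∀ X ∈ 𝔤, ∀ u ∈ U, X.baseChange ℂ u ∈ U) :
    U = ⊥ ∨ U = H.eigenBlock τ := by
  classical
  obtain ⟨U', hc, -, hπcomm⟩ := SpBlocksTheta.exists_isCompl_of_stable H hn heff ψ 𝔤 hΘ hΘ𝔤 hskew hU
  have hπspan := ThetaSubalgebra.mem_span_endAlg_of_forall_commute H 𝔤 hΘ hΘ𝔤 hπcomm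
  obtain ⟨c, hcs⟩ := exists_forall_apply_eq_smul_of_mem_span_endAlg (H := H) (fun a => τ a) hπspan
  by_cases hU0 : U = ⊥
  · exact Or.inl hU0
  right
  obtain ⟨u₀, hu₀U, hu₀0⟩ := (Submodule.ne_bot_iff U).1 hU0
  have hc1 : c = 1 := by
    have h : U.projection U' hc u₀ = u₀ := Submodule.projection_apply_of_mem_left hc hu₀U
    rw [hcs u₀ ((H.mem_eigenBlock_iff τ u₀).1 (hUT hu₀U))] at h
    have h' : (c - 1) • u₀ = 0 := by rw [sub_smul, one_smul, h, sub_self]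
    exact sub_eq_zero.1 ((smul_eq_zero.1 h').resolve_right hu₀0)
  refine le_antisymm hUT fun x hx => ?_
  have h := hcs x ((H.mem_eigenBlock_iff τ x).1 hx)
  rw [hc1, one_smul] at h
  rw [← h]
  exact Submodule.projection_apply_mem hc x

omit [HodgeTensorFacts.{u, u}] in
/-- **Irreducibility, restricted form** (as consumed by the core theorem on a block): for a family `𝔊` of operators of `T_τ`
containing the restriction of every element of `𝔤_ℂ`, a `𝔊`-stable subspace of `T_τ` is `0` or `T_τ`.
[cite: Zarhin1983HodgeGroupsK3, §2] -/
theorem SpBlocksTheta.eq_bot_or_top_of_stable (H : HodgeStructure V n) (hn : n = 1) (heff : H.IsEffective)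
    (ψ : H.Polarization) (𝔤 : Submodule ℚ (Module.End ℚ V)) {Θ : Module.End ℂ (ℂ ⊗[ℚ] V)}
    (hΘ : ∀ p, ∀ x ∈ H.piece p (n - p), Θ x = ((2 * p - n : ℤ) : ℂ) • x) (hΘ𝔤 : Θ ∈ spanC 𝔤)
    (hskew : ∀ X ∈ 𝔤, ∀ v w, ψ.form (X v) w + ψ.form v (X w) = 0) (τ : H.endAlg →+* ℂ)
    (𝔊 : Submodule ℂ (Module.End ℂ ↥(H.eigenBlock τ)))
    (h𝔊 : ∀ Y ∈ spanC 𝔤, ∃ g ∈ 𝔊, ∀ x : H.eigenBlock τ, ((g x : H.eigenBlock τ) : ℂ ⊗[ℚ] V) = Y x)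
    (U : Submodule ℂ ↥(H.eigenBlock τ)) (hU : ∀ g ∈ 𝔊, ∀ u ∈ U, g u ∈ U) : U = ⊥ ∨ U = ⊤ := by
  set U' : Submodule ℂ (ℂ ⊗[ℚ] V) := U.map (H.eigenBlock τ).subtype with hU'
  have hU'le : U' ≤ H.eigenBlock τ := by
    rintro _ ⟨u, -, rfl⟩
    exact u.2
  have hU'stab : ∀ X ∈ 𝔤, ∀ x ∈ U', X.baseChange ℂ x ∈ U' := by
    rintro X hX _ ⟨u, hu, rfl⟩
    obtain ⟨g, hg, hgY⟩ := h𝔊 _ (baseChange_mem_spanC hX)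
    exact ⟨g u, hU g hg u hu, hgY u⟩
  rcases SpBlocksTheta.eq_bot_or_eq_block_of_stable H hn heff ψ 𝔤 hΘ hΘ𝔤 hskew τ hU'le hU'stab with h | h
  · left
    rw [eq_bot_iff]
    intro u hu
    rw [Submodule.mem_bot]
    have h1 : (u : ℂ ⊗[ℚ] V) ∈ U' := ⟨u, hu, rfl⟩
    rw [h, Submodule.mem_bot] at h1
    exact Subtype.ext h1
  · right
    rw [eq_top_iff]
    intro u _
    have hu : (u : ℂ ⊗[ℚ] V) ∈ U' := by rw [h]; exact u.2
    obtain ⟨u', hu', huu'⟩ := hu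
    have : u' = u := Subtype.ext huu'
    rw [← this]
    exact hu'

/-! ### §2 `𝔤_ℂ` restricts ONTO `𝔰𝔭(T_i)` on every four-dimensional real block -/

omit [HodgeTensorFacts.{u, u}] in
/-- **`𝔤_ℂ` restricts onto `𝔰𝔭(T_i, ψ_ℂ|_{T_i})` on each four-dimensional real eigenblock, for EVERY admissible `𝔤`**
(Moonen–Zarhin 1995 Type I(2) «`Hg = R_{F/ℚ} Sp_{4,F}`», per place, for an arbitrary rational Lie algebra containing `Θ`
after complexification). For every `i` and every `ℂ`-linear `g : T_i → T_i` skew for `ψ_ℂ|_{T_i}` there is `Y ∈ 𝔤_ℂ` with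
`Y x = g x` on `T_i`: the restrictions `{Y|_{T_i}}` form a bracket-closed space of skew operators for the non-degenerate
alternating `ψ_ℂ|_{T_i}` containing the involution `Θ|_{T_i}` (eigen-planes `T_i ∩ V^{1,0}`, `T_i ∩ V^{0,1}`) and acting
irreducibly (§1), so the core theorem `SymplecticTheta.core_of_irreducible` for `T = ±Θ|_{T_i}` gives everything
(proof of the tree's `SymplecticBlocks.exists_mem_hodgeLieC_restrict_eq`, verbatim but for the inputs).
[cite: MoonenZarhin1995Duke, Type I(2)] [cite: MoonenZarhin1999LowDim, §2 (2.2) and §3 (3.1)] [cite: GoodmanWallachGTM255, §2.1.2] -/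
theorem SpBlocksTheta.exists_mem_spanC_restrict_eq (H : HodgeStructure V n) (hn : n = 1) (heff : H.IsEffective)
    (ψ : H.Polarization)
    (hself : ∀ a : H.endAlg, LinearMap.IsAdjointPair ψ.form ψ.form (a : Module.End ℚ V) (a : Module.End ℚ V))
    (σ : ι → (H.endAlg →+* ℂ)) (hreal : ∀ i, (starRingEnd ℂ).comp (σ i) = σ i)
    (hint : DirectSum.IsInternal fun i => H.eigenBlock (σ i)) (h4 : ∀ i, Module.finrank ℂ (H.eigenBlock (σ i)) = 4)
    (𝔤 : Submodule ℚ (Module.End ℚ V)) (hbr : ∀ X ∈ 𝔤, ∀ X' ∈ 𝔤, X * X' - X' * X ∈ 𝔤) {Θ : Module.End ℂ (ℂ ⊗[ℚ] V)}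
    (hΘ : ∀ p, ∀ x ∈ H.piece p (n - p), Θ x = ((2 * p - n : ℤ) : ℂ) • x) (hΘ𝔤 : Θ ∈ spanC 𝔤)
    (hcomm : ∀ X ∈ 𝔤, ∀ a : H.endAlg, X * (a : Module.End ℚ V) = (a : Module.End ℚ V) * X)
    (hskew : ∀ X ∈ 𝔤, ∀ v w, ψ.form (X v) w + ψ.form v (X w) = 0) (i : ι) :
    ∀ g : Module.End ℂ ↥(H.eigenBlock (σ i)),
      (∀ x y : H.eigenBlock (σ i), ψ.form.baseChange ℂ ((g x : H.eigenBlock (σ i)) : ℂ ⊗[ℚ] V) y +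
        ψ.form.baseChange ℂ (x : ℂ ⊗[ℚ] V) ((g y : H.eigenBlock (σ i)) : ℂ ⊗[ℚ] V) = 0) →
      ∃ Y ∈ spanC 𝔤, ∀ x : H.eigenBlock (σ i), ((g x : H.eigenBlock (σ i)) : ℂ ⊗[ℚ] V) = Y x := by
  classical
  subst hn
  set T := H.eigenBlock (σ i) with hT
  intro g hg
  obtain ⟨hPv, hQv, hΘ10, hΘ01, hΘΘ⟩ := UnitaryTheta.theta_facts H rfl heff hΘ
  have hYT : ∀ Y ∈ spanC 𝔤, ∀ x ∈ T, Y x ∈ T := fun Y hY x hx => SpBlocksTheta.apply_mem_eigenBlock H σ hcomm hY i hx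
  have hYskew : ∀ Y ∈ spanC 𝔤, ∀ x y, ψ.form.baseChange ℂ (Y x) y + ψ.form.baseChange ℂ x (Y y) = 0 :=
    fun Y hY => ThetaSubalgebra.formBaseChange_add_eq_zero_of_mem_spanC ψ hskew hY
  -- the restricted form `ω`
  set ω : LinearMap.BilinForm ℂ ↥T := (ψ.form.baseChange ℂ).compl₁₂ T.subtype T.subtype with hω
  have hω_apply : ∀ x y : T, ω x y = ψ.form.baseChange ℂ (x : ℂ ⊗[ℚ] V) y := fun x y => rfl
  have hsepL : ∀ x : T, (∀ y : T, ω x y = 0) → x = 0 := by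
    intro x hx
    have h0 : (x : ℂ ⊗[ℚ] V) = 0 :=
      SymplecticBlocks.eq_zero_of_forall_block H ψ hself σ hint i x.2 fun y hy => by
        have h := hx ⟨y, hy⟩
        rwa [hω_apply] at h
    exact Subtype.ext h0
  have hωalt : ∀ x y : T, ω x y = -ω y x := fun x y => by
    rw [hω_apply, hω_apply, form_baseChange_swap_of_odd H odd_one ψ]
  have hωnd : ω.Nondegenerate := by
    refine ⟨fun x hx => hsepL x hx, fun y hy => hsepL y fun x => ?_⟩
    rw [hωalt, hy x, neg_zero]
  -- the Lie algebra of restrictions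
  let 𝔊 : Submodule ℂ (Module.End ℂ ↥T) :=
    { carrier := {g' | ∃ Y ∈ spanC 𝔤, ∀ x : T, ((g' x : T) : ℂ ⊗[ℚ] V) = Y x}
      zero_mem' := ⟨0, Submodule.zero_mem _, fun x => by simp⟩
      add_mem' := by
        rintro g₁ g₂ ⟨Y₁, hY₁, h₁⟩ ⟨Y₂, hY₂, h₂⟩
        exact ⟨Y₁ + Y₂, Submodule.add_mem _ hY₁ hY₂, fun x => by
          rw [LinearMap.add_apply, Submodule.coe_add, h₁, h₂, LinearMap.add_apply]⟩
      smul_mem' := by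
        rintro c g' ⟨Y, hY, h⟩
        exact ⟨c • Y, Submodule.smul_mem _ c hY, fun x => by
          rw [LinearMap.smul_apply, Submodule.coe_smul, h, LinearMap.smul_apply]⟩ }
  have hmem𝔊 : ∀ g', g' ∈ 𝔊 ↔ ∃ Y ∈ spanC 𝔤, ∀ x : T, ((g' x : T) : ℂ ⊗[ℚ] V) = Y x := fun g' => Iff.rfl
  have hrestr : ∀ Y ∈ spanC 𝔤, ∃ g' ∈ 𝔊, ∀ x : T, ((g' x : T) : ℂ ⊗[ℚ] V) = Y x := fun Y hY =>
    ⟨Y.restrict fun x hx => hYT Y hY x hx, (hmem𝔊 _).2 ⟨Y, hY, fun x => rfl⟩, fun x => rfl⟩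
  have h𝔊br : ∀ g₁ ∈ 𝔊, ∀ g₂ ∈ 𝔊, g₁ * g₂ - g₂ * g₁ ∈ 𝔊 := by
    rintro g₁ ⟨Y₁, hY₁, h₁⟩ g₂ ⟨Y₂, hY₂, h₂⟩
    refine (hmem𝔊 _).2 ⟨Y₁ * Y₂ - Y₂ * Y₁, commutator_mem_spanC hbr hY₁ hY₂, fun x => ?_⟩
    rw [LinearMap.sub_apply, Submodule.coe_sub, Module.End.mul_apply, Module.End.mul_apply, h₁, h₂, h₂, h₁,
      LinearMap.sub_apply, Module.End.mul_apply, Module.End.mul_apply]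
  have h𝔊skew : ∀ g' ∈ 𝔊, ∀ x y : T, ω (g' x) y + ω x (g' y) = 0 := by
    rintro g' ⟨Y, hY, h⟩ x y
    rw [hω_apply, hω_apply, h, h]
    exact hYskew Y hY _ _
  -- the involution `Θ|_T` and its eigen-planes
  set TΘ : Module.End ℂ ↥T := Θ.restrict fun x hx => hYT Θ hΘ𝔤 x hx with hTΘ
  have hTΘ_coe : ∀ x : T, ((TΘ x : T) : ℂ ⊗[ℚ] V) = Θ x := fun x => rfl
  have hTΘ𝔊 : TΘ ∈ 𝔊 := (hmem𝔊 _).2 ⟨Θ, hΘ𝔤, hTΘ_coe⟩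
  have hTΘΘ : ∀ v : T, TΘ (TΘ v) = v := fun v => Subtype.ext (by rw [hTΘ_coe, hTΘ_coe, hΘΘ])
  set P : Submodule ℂ ↥T := (H.piece 1 0).comap T.subtype with hPdef
  set Q : Submodule ℂ ↥T := (H.piece 0 1).comap T.subtype with hQdef
  have hP : ∀ x ∈ P, TΘ x = x := fun x hx => Subtype.ext (by rw [hTΘ_coe]; exact hΘ10 _ hx)
  have hQ : ∀ x ∈ Q, TΘ x = -x := fun x hx => Subtype.ext (by rw [hTΘ_coe, Submodule.coe_neg]; exact hΘ01 _ hx)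
  have hPmem : ∀ v : T, (2 : ℂ)⁻¹ • (v + TΘ v) ∈ P := fun v => by
    change (((2 : ℂ)⁻¹ • (v + TΘ v) : T) : ℂ ⊗[ℚ] V) ∈ H.piece 1 0
    rw [Submodule.coe_smul, Submodule.coe_add, hTΘ_coe]
    exact hPv _
  have hQmem : ∀ v : T, (2 : ℂ)⁻¹ • (v - TΘ v) ∈ Q := fun v => by
    change (((2 : ℂ)⁻¹ • (v - TΘ v) : T) : ℂ ⊗[ℚ] V) ∈ H.piece 0 1
    rw [Submodule.coe_smul, Submodule.coe_sub, hTΘ_coe]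
    exact hQv _
  -- dimensions of the eigen-planes
  have hTconj : ∀ x ∈ T, conj x ∈ T := fun x hx => SymplecticBlocks.conj_mem_eigenBlock_of_real H (hreal i) hx
  obtain ⟨hP2', hQ2'⟩ := SymplecticBlocks.finrank_inf_piece_eq_two H rfl heff hΘ hTconj (hYT Θ hΘ𝔤) (h4 i)
  have hPeq : P = (T ⊓ H.piece 1 0).comap T.subtype := by
    ext x
    simp only [hPdef, Submodule.mem_comap, Submodule.coe_subtype, Submodule.mem_inf, SetLike.coe_mem, true_and]
  have hQeq : Q = (T ⊓ H.piece 0 1).comap T.subtype := by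
    ext x
    simp only [hQdef, Submodule.mem_comap, Submodule.coe_subtype, Submodule.mem_inf, SetLike.coe_mem, true_and]
  have hP2 : Module.finrank ℂ P = 2 := by
    rw [hPeq, (Submodule.comapSubtypeEquivOfLe (inf_le_left : T ⊓ H.piece 1 0 ≤ T)).finrank_eq, hP2']
  have hQ2 : Module.finrank ℂ Q = 2 := by
    rw [hQeq, (Submodule.comapSubtypeEquivOfLe (inf_le_left : T ⊓ H.piece 0 1 ≤ T)).finrank_eq, hQ2']
  -- irreducibility
  have hirr : ∀ U : Submodule ℂ ↥T, (∀ Z ∈ 𝔊, ∀ u ∈ U, Z u ∈ U) → U = ⊥ ∨ U = ⊤ :=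
    fun U hU => SpBlocksTheta.eq_bot_or_top_of_stable H rfl heff ψ 𝔤 hΘ hΘ𝔤 hskew (σ i) 𝔊 hrestr U hU
  -- the core theorem for `T = Θ|_T` and `T = -Θ|_T`
  have hnΘ𝔊 : -TΘ ∈ 𝔊 := (hmem𝔊 _).2 ⟨-Θ, Submodule.neg_mem _ hΘ𝔤, fun x => by
    rw [LinearMap.neg_apply, Submodule.coe_neg, hTΘ_coe, LinearMap.neg_apply]⟩
  have hnΘΘ : ∀ v : T, (-TΘ) ((-TΘ) v) = v := fun v => by
    rw [LinearMap.neg_apply, LinearMap.neg_apply, map_neg, neg_neg, hTΘΘ]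
  have hP' : ∀ x ∈ Q, (-TΘ) x = x := fun x hx => by rw [LinearMap.neg_apply, hQ x hx, neg_neg]
  have hQ' : ∀ x ∈ P, (-TΘ) x = -x := fun x hx => by rw [LinearMap.neg_apply, hP x hx]
  have hPmem' : ∀ v : T, (2 : ℂ)⁻¹ • (v + (-TΘ) v) ∈ Q := fun v => by
    rw [LinearMap.neg_apply, ← sub_eq_add_neg]; exact hQmem v
  have hQmem' : ∀ v : T, (2 : ℂ)⁻¹ • (v - (-TΘ) v) ∈ P := fun v => by
    rw [LinearMap.neg_apply, sub_neg_eq_add]; exact hPmem v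
  obtain ⟨hA, hB⟩ := SymplecticTheta.core_of_irreducible ω hωnd hωalt 𝔊 h𝔊br h𝔊skew hTΘ𝔊 hTΘΘ
    (P := P) (Q := Q) hP hQ hPmem hQmem hP2 hQ2 hirr
  obtain ⟨hA', -⟩ := SymplecticTheta.core_of_irreducible ω hωnd hωalt 𝔊 h𝔊br h𝔊skew hnΘ𝔊 hnΘΘ
    (P := Q) (Q := P) hP' hQ' hPmem' hQmem' hQ2 hP2 hirr
  -- the space of `ω`-skew operators on `T` and the grading of `g`
  let 𝔰 : Submodule ℂ (Module.End ℂ ↥T) :=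
    { carrier := {Z | ∀ x y : T, ω (Z x) y + ω x (Z y) = 0}
      zero_mem' := fun x y => by simp
      add_mem' := by
        intro Z Z' hZ hZ' x y
        simp only [LinearMap.add_apply, map_add]
        have h1 := hZ x y
        have h2 := hZ' x y
        linear_combination h1 + h2
      smul_mem' := by
        intro c Z hZ x y
        simp only [LinearMap.smul_apply, map_smul, smul_eq_mul]
        have h1 := hZ x y
        linear_combination c * h1 }
  have hmem𝔰 : ∀ Z, Z ∈ 𝔰 ↔ ∀ x y : T, ω (Z x) y + ω x (Z y) = 0 := fun Z => Iff.rfl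
  have h𝔰br : ∀ Z ∈ 𝔰, ∀ Z' ∈ 𝔰, Z * Z' - Z' * Z ∈ 𝔰 := by
    intro Z hZ Z' hZ' x y
    simp only [LinearMap.sub_apply, Module.End.mul_apply, map_sub, LinearMap.sub_apply]
    have h1 := (hmem𝔰 Z).1 hZ (Z' x) y
    have h2 := (hmem𝔰 Z').1 hZ' x (Z y)
    have h3 := (hmem𝔰 Z').1 hZ' (Z x) y
    have h4 := (hmem𝔰 Z).1 hZ x (Z' y)
    linear_combination h1 - h3 + h4 - h2
  have hΘ𝔰 : TΘ ∈ 𝔰 := (hmem𝔰 TΘ).2 (h𝔊skew TΘ hTΘ𝔊)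
  have hg𝔰 : g ∈ 𝔰 := (hmem𝔰 g).2 fun x y => by rw [hω_apply, hω_apply]; exact hg x y
  obtain ⟨Ym, hYm, Y0, hY0, Yp, hYp, hYeq, hYpP, hYpim, hYmQ, hYmim, -, -, hY0P, hY0Q⟩ :=
    SymplecticTheta.exists_decomp 𝔰 h𝔰br hΘ𝔰 hTΘΘ (P := P) (Q := Q) hP hQ hPmem hQmem hg𝔰
  have hg𝔊 : g ∈ 𝔊 := by
    rw [hYeq]
    refine Submodule.add_mem _ (Submodule.add_mem _ ?_ ?_) ?_
    · exact hA' Ym ((hmem𝔰 Ym).1 hYm) hYmQ hYmim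
    · exact hB Y0 ((hmem𝔰 Y0).1 hY0) hY0P hY0Q
    · exact hA Yp ((hmem𝔰 Yp).1 hYp) hYpP hYpim
  exact (hmem𝔊 g).1 hg𝔊

/-! ### §3 Ideals of `𝔤_ℂ` on a block; `𝔤_ℂ` is semisimple -/

/-- **An ideal of `𝔤_ℂ` either kills the block `T_j` or restricts ONTO `𝔰𝔭(T_j)`** (its restrictions form an ideal of
`𝔰𝔭(T_j) = c_j(𝔤_ℂ)` by §2, and «`𝔰𝔭₄` is simple», `SymplecticIdeal.mem_of_ne_bot`); the tree's
`SymplecticBlocks.restrict_ideal_dichotomy` for an arbitrary admissible algebra. [cite: MoonenZarhin1999LowDim, §3 (3.1) and Lemma (3.4)]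
[cite: Humphreys1972, §5.2] -/
theorem SpBlocksTheta.restrict_ideal_dichotomy (H : HodgeStructure V n) (hn : n = 1) (heff : H.IsEffective)
    (ψ : H.Polarization)
    (hself : ∀ a : H.endAlg, LinearMap.IsAdjointPair ψ.form ψ.form (a : Module.End ℚ V) (a : Module.End ℚ V))
    (σ : ι → (H.endAlg →+* ℂ)) (hreal : ∀ i, (starRingEnd ℂ).comp (σ i) = σ i)
    (hint : DirectSum.IsInternal fun i => H.eigenBlock (σ i)) (h4 : ∀ i, Module.finrank ℂ (H.eigenBlock (σ i)) = 4)
    (𝔤 : Submodule ℚ (Module.End ℚ V)) (hbr : ∀ X ∈ 𝔤, ∀ X' ∈ 𝔤, X * X' - X' * X ∈ 𝔤) {Θ : Module.End ℂ (ℂ ⊗[ℚ] V)}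
    (hΘ : ∀ p, ∀ x ∈ H.piece p (n - p), Θ x = ((2 * p - n : ℤ) : ℂ) • x) (hΘ𝔤 : Θ ∈ spanC 𝔤)
    (hcomm : ∀ X ∈ 𝔤, ∀ a : H.endAlg, X * (a : Module.End ℚ V) = (a : Module.End ℚ V) * X)
    (hskew : ∀ X ∈ 𝔤, ∀ v w, ψ.form (X v) w + ψ.form v (X w) = 0)
    (N : Submodule ℂ (Module.End ℂ (ℂ ⊗[ℚ] V))) (hN : N ≤ spanC 𝔤)
    (hNideal : ∀ W ∈ spanC 𝔤, ∀ Y ∈ N, W * Y - Y * W ∈ N) (j : ι) :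
    (∀ Y ∈ N, ∀ x ∈ H.eigenBlock (σ j), Y x = 0) ∨
      ∀ g : Module.End ℂ ↥(H.eigenBlock (σ j)),
        (∀ x y : H.eigenBlock (σ j), ψ.form.baseChange ℂ ((g x : H.eigenBlock (σ j)) : ℂ ⊗[ℚ] V) y +
          ψ.form.baseChange ℂ (x : ℂ ⊗[ℚ] V) ((g y : H.eigenBlock (σ j)) : ℂ ⊗[ℚ] V) = 0) →
        ∃ Y ∈ N, ∀ x : H.eigenBlock (σ j), ((g x : H.eigenBlock (σ j)) : ℂ ⊗[ℚ] V) = Y x := by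
  classical
  obtain ⟨hωnd, hωalt, TΘ, P, Q, hTΘ, hTT, hTskew, hP, hQ, hPmem, hQmem, hP2, hQ2⟩ :=
    SymplecticBlocks.exists_blockData H hn heff ψ hself σ hreal hint h4 hΘ j
  set T := H.eigenBlock (σ j) with hT
  set ω : LinearMap.BilinForm ℂ ↥T := (ψ.form.baseChange ℂ).compl₁₂ T.subtype T.subtype with hω
  have hω_apply : ∀ x y : T, ω x y = ψ.form.baseChange ℂ (x : ℂ ⊗[ℚ] V) y := fun x y => rfl
  have hYT : ∀ Y ∈ spanC 𝔤, ∀ x ∈ T, Y x ∈ T := fun Y hY x hx => SpBlocksTheta.apply_mem_eigenBlock H σ hcomm hY j hx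
  have hYskew : ∀ Y ∈ spanC 𝔤, ∀ x y, ψ.form.baseChange ℂ (Y x) y + ψ.form.baseChange ℂ x (Y y) = 0 :=
    fun Y hY => ThetaSubalgebra.formBaseChange_add_eq_zero_of_mem_spanC ψ hskew hY
  -- the restrictions of `N`
  let I : Submodule ℂ (Module.End ℂ ↥T) :=
    { carrier := {g | ∃ Y ∈ N, ∀ x : T, ((g x : T) : ℂ ⊗[ℚ] V) = Y x}
      zero_mem' := ⟨0, N.zero_mem, fun x => by simp⟩
      add_mem' := by
        rintro g₁ g₂ ⟨Y₁, hY₁, h₁⟩ ⟨Y₂, hY₂, h₂⟩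
        exact ⟨Y₁ + Y₂, N.add_mem hY₁ hY₂, fun x => by rw [LinearMap.add_apply, Submodule.coe_add, h₁, h₂, LinearMap.add_apply]⟩
      smul_mem' := by
        rintro c g ⟨Y, hY, h⟩
        exact ⟨c • Y, N.smul_mem c hY, fun x => by rw [LinearMap.smul_apply, Submodule.coe_smul, h, LinearMap.smul_apply]⟩ }
  have hmemI : ∀ g, g ∈ I ↔ ∃ Y ∈ N, ∀ x : T, ((g x : T) : ℂ ⊗[ℚ] V) = Y x := fun g => Iff.rfl
  have hIskew : ∀ g ∈ I, ∀ x y : T, ω (g x) y + ω x (g y) = 0 := by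
    rintro g ⟨Y, hY, h⟩ x y
    rw [hω_apply, hω_apply, h, h]
    exact hYskew Y (hN hY) _ _
  -- `I` is an ideal of `𝔰𝔭(T)`: every skew `Z` on `T` is a restriction of some `W ∈ 𝔤_ℂ` (§2)
  have hI : ∀ Z : Module.End ℂ ↥T, (∀ x y : T, ω (Z x) y + ω x (Z y) = 0) → ∀ g ∈ I, Z * g - g * Z ∈ I := by
    rintro Z hZ g ⟨Y, hY, h⟩
    obtain ⟨W, hW, hWZ⟩ := SpBlocksTheta.exists_mem_spanC_restrict_eq H hn heff ψ hself σ hreal hint h4 𝔤 hbr hΘ hΘ𝔤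
      hcomm hskew j Z (fun x y => by rw [← hω_apply, ← hω_apply]; exact hZ x y)
    refine (hmemI _).2 ⟨W * Y - Y * W, hNideal W hW Y hY, fun x => ?_⟩
    rw [LinearMap.sub_apply, Submodule.coe_sub, Module.End.mul_apply, Module.End.mul_apply, hWZ, h, h, hWZ, LinearMap.sub_apply,
      Module.End.mul_apply, Module.End.mul_apply]
  by_cases hI0 : I = ⊥
  · left
    intro Y hY x hx
    have hg : Y.restrict (fun x hx => hYT Y (hN hY) x hx) ∈ I := (hmemI _).2 ⟨Y, hY, fun x => rfl⟩
    rw [hI0, Submodule.mem_bot] at hg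
    have h := congrArg (fun g : Module.End ℂ ↥T => ((g ⟨x, hx⟩ : T) : ℂ ⊗[ℚ] V)) hg
    simpa using h
  · right
    intro g hg
    have hgI : g ∈ I := SymplecticIdeal.mem_of_ne_bot ω hωnd hωalt hTT hTskew hP hQ hPmem hQmem hP2 hQ2 I hIskew hI hI0
      (fun x y => by rw [hω_apply, hω_apply]; exact hg x y)
    exact (hmemI g).1 hgI

/-- **An element of `𝔤_ℂ` whose restriction to `T_j` commutes with the restrictions of a subspace `N` that restricts ONTO
`𝔰𝔭(T_j)` kills `T_j`** («`𝔰𝔭₄` has trivial centre», `SymplecticIdeal.eq_zero_of_forall_bracket_eq_zero`); the tree's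
`SymplecticBlocks.apply_eq_zero_of_forall_commute` for an admissible algebra. [cite: MoonenZarhin1999LowDim, §3 (3.1) and Lemma (3.4)]
[cite: Humphreys1972, §5.2] -/
theorem SpBlocksTheta.apply_eq_zero_of_forall_commute (H : HodgeStructure V n) (hn : n = 1) (heff : H.IsEffective)
    (ψ : H.Polarization)
    (hself : ∀ a : H.endAlg, LinearMap.IsAdjointPair ψ.form ψ.form (a : Module.End ℚ V) (a : Module.End ℚ V))
    (σ : ι → (H.endAlg →+* ℂ)) (hreal : ∀ i, (starRingEnd ℂ).comp (σ i) = σ i)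
    (hint : DirectSum.IsInternal fun i => H.eigenBlock (σ i)) (h4 : ∀ i, Module.finrank ℂ (H.eigenBlock (σ i)) = 4)
    (𝔤 : Submodule ℚ (Module.End ℚ V)) {Θ : Module.End ℂ (ℂ ⊗[ℚ] V)}
    (hΘ : ∀ p, ∀ x ∈ H.piece p (n - p), Θ x = ((2 * p - n : ℤ) : ℂ) • x)
    (hcomm : ∀ X ∈ 𝔤, ∀ a : H.endAlg, X * (a : Module.End ℚ V) = (a : Module.End ℚ V) * X)
    (hskew : ∀ X ∈ 𝔤, ∀ v w, ψ.form (X v) w + ψ.form v (X w) = 0) (j : ι)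
    (N : Submodule ℂ (Module.End ℂ (ℂ ⊗[ℚ] V)))
    (hNonto : ∀ g : Module.End ℂ ↥(H.eigenBlock (σ j)),
        (∀ x y : H.eigenBlock (σ j), ψ.form.baseChange ℂ ((g x : H.eigenBlock (σ j)) : ℂ ⊗[ℚ] V) y +
          ψ.form.baseChange ℂ (x : ℂ ⊗[ℚ] V) ((g y : H.eigenBlock (σ j)) : ℂ ⊗[ℚ] V) = 0) →
        ∃ Y ∈ N, ∀ x : H.eigenBlock (σ j), ((g x : H.eigenBlock (σ j)) : ℂ ⊗[ℚ] V) = Y x)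
    {Z : Module.End ℂ (ℂ ⊗[ℚ] V)} (hZ : Z ∈ spanC 𝔤) (hc : ∀ Y ∈ N, ∀ x ∈ H.eigenBlock (σ j), (Y * Z - Z * Y) x = 0)
    {x : ℂ ⊗[ℚ] V} (hx : x ∈ H.eigenBlock (σ j)) : Z x = 0 := by
  classical
  obtain ⟨hωnd, hωalt, TΘ, P, Q, hTΘ, hTT, hTskew, hP, hQ, hPmem, hQmem, hP2, hQ2⟩ :=
    SymplecticBlocks.exists_blockData H hn heff ψ hself σ hreal hint h4 hΘ j
  set T := H.eigenBlock (σ j) with hT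
  set ω : LinearMap.BilinForm ℂ ↥T := (ψ.form.baseChange ℂ).compl₁₂ T.subtype T.subtype with hω
  have hω_apply : ∀ x y : T, ω x y = ψ.form.baseChange ℂ (x : ℂ ⊗[ℚ] V) y := fun x y => rfl
  have hYT : ∀ Y ∈ spanC 𝔤, ∀ x ∈ T, Y x ∈ T := fun Y hY x hx => SpBlocksTheta.apply_mem_eigenBlock H σ hcomm hY j hx
  set ZT : Module.End ℂ ↥T := Z.restrict fun x hx => hYT Z hZ x hx with hZT
  have hZT_coe : ∀ x : T, ((ZT x : T) : ℂ ⊗[ℚ] V) = Z x := fun x => rfl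
  have hZTskew : ∀ x y : T, ω (ZT x) y + ω x (ZT y) = 0 := fun x y => by
    rw [hω_apply, hω_apply, hZT_coe, hZT_coe]
    exact ThetaSubalgebra.formBaseChange_add_eq_zero_of_mem_spanC ψ hskew hZ _ _
  have h0 : ZT = 0 := by
    refine SymplecticIdeal.eq_zero_of_forall_bracket_eq_zero ω hωnd hωalt hTT hTskew hP hQ hPmem hQmem hP2 hQ2 hZTskew fun W hW => ?_
    obtain ⟨Y, hY, hYW⟩ := hNonto W fun x y => by rw [← hω_apply, ← hω_apply]; exact hW x y
    refine LinearMap.ext fun y => Subtype.ext ?_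
    rw [LinearMap.sub_apply, Submodule.coe_sub, Module.End.mul_apply, Module.End.mul_apply, hYW, hZT_coe, hZT_coe, hYW,
      LinearMap.zero_apply, Submodule.coe_zero]
    have h := hc Y hY y y.2
    rwa [LinearMap.sub_apply, Module.End.mul_apply, Module.End.mul_apply] at h
  have h := hZT_coe ⟨x, hx⟩
  rw [h0, LinearMap.zero_apply, Submodule.coe_zero] at h
  exact h.symm

omit [Module.Finite ℚ V] [HodgeTensorFacts.{u, u}] in
/-- `𝔤_ℂ = spanC 𝔤` is (the carrier of) a Lie subalgebra of `𝔤𝔩(V_ℂ)` for the commutator bracket, for `𝔤` bracket-closed.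
Stated as an existence so that no notion is introduced. [cite: Deligne1982HodgeCycles, I §3 Prop. 3.4] -/
theorem SpBlocksTheta.exists_lieSubalgebra_eq_spanC (𝔤 : Submodule ℚ (Module.End ℚ V))
    (hbr : ∀ X ∈ 𝔤, ∀ X' ∈ 𝔤, X * X' - X' * X ∈ 𝔤) :
    letI : LieRing (Module.End ℂ (ℂ ⊗[ℚ] V)) := LieRing.ofAssociativeRing
    ∃ 𝔏 : LieSubalgebra ℂ (Module.End ℂ (ℂ ⊗[ℚ] V)), 𝔏.toSubmodule = spanC 𝔤 := by
  letI : LieRing (Module.End ℂ (ℂ ⊗[ℚ] V)) := LieRing.ofAssociativeRing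
  exact ⟨{ spanC 𝔤 with
      lie_mem' := fun {Y Z} hY hZ => by
        rw [LieRing.of_associative_ring_bracket]
        exact commutator_mem_spanC hbr hY hZ }, rfl⟩

omit [HodgeTensorFacts.{u, u}] in
/-- **`V_ℂ` is a completely reducible `𝔏`-module** for every Lie subalgebra `𝔏 ≤ 𝔤𝔩(V_ℂ)` with carrier `𝔤_ℂ`, `𝔤`
admissible (§1 `exists_isCompl_of_stable`). [cite: Deligne1982HodgeCycles, I §3 Prop. 3.4] [cite: Humphreys1972, §19.1] -/
theorem SpBlocksTheta.complementedLattice_lieSubmodule (H : HodgeStructure V n) (hn : n = 1) (heff : H.IsEffective)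
    (ψ : H.Polarization) (𝔤 : Submodule ℚ (Module.End ℚ V)) {Θ : Module.End ℂ (ℂ ⊗[ℚ] V)}
    (hΘ : ∀ p, ∀ x ∈ H.piece p (n - p), Θ x = ((2 * p - n : ℤ) : ℂ) • x) (hΘ𝔤 : Θ ∈ spanC 𝔤)
    (hskew : ∀ X ∈ 𝔤, ∀ v w, ψ.form (X v) w + ψ.form v (X w) = 0) :
    letI : LieRing (Module.End ℂ (ℂ ⊗[ℚ] V)) := LieRing.ofAssociativeRing
    ∀ (𝔏 : LieSubalgebra ℂ (Module.End ℂ (ℂ ⊗[ℚ] V))), 𝔏.toSubmodule = spanC 𝔤 →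
      ComplementedLattice (LieSubmodule ℂ 𝔏 (ℂ ⊗[ℚ] V)) := by
  letI : LieRing (Module.End ℂ (ℂ ⊗[ℚ] V)) := LieRing.ofAssociativeRing
  intro 𝔏 h𝔏
  refine ⟨fun N => ?_⟩
  have hmem : ∀ Y : Module.End ℂ (ℂ ⊗[ℚ] V), Y ∈ spanC 𝔤 ↔ Y ∈ 𝔏 := fun Y => by
    rw [← LieSubalgebra.mem_toSubmodule, h𝔏]
  have hN : ∀ X ∈ 𝔤, ∀ x ∈ (N : Submodule ℂ (ℂ ⊗[ℚ] V)), X.baseChange ℂ x ∈ (N : Submodule ℂ (ℂ ⊗[ℚ] V)) := by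
    intro X hX x hx
    have h := N.lie_mem (x := ⟨X.baseChange ℂ, (hmem _).1 (baseChange_mem_spanC hX)⟩) hx
    rwa [LieSubalgebra.coe_bracket_of_module, Module.End.lie_apply] at h
  obtain ⟨U', hc, hU', -⟩ := SpBlocksTheta.exists_isCompl_of_stable H hn heff ψ 𝔤 hΘ hΘ𝔤 hskew hN
  let N' : LieSubmodule ℂ 𝔏 (ℂ ⊗[ℚ] V) :=
    { U' with
      lie_mem := fun {Y x} hx => by
        rw [LieSubalgebra.coe_bracket_of_module, Module.End.lie_apply]
        exact mapsTo_of_mem_spanC (T := U') (fun X hX => fun y hy => hU' X hX y hy) ((hmem _).2 Y.2) hx }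
  refine ⟨N', ?_⟩
  rw [← LieSubmodule.isCompl_toSubmodule]
  exact hc

/-- **`𝔤_ℂ` is a SEMISIMPLE Lie algebra** (four-dimensional real blocks, `𝔤` admissible): `V_ℂ` is a faithful completely
reducible `𝔏`-module, so the radical is central (Lie's theorem, `Literature.Algebra.Lie.hasCentralRadical_of_complementedLattice`);
a central element commutes on every block with `𝔤_ℂ|_{T_j} = 𝔰𝔭(T_j)` and therefore kills every block (trivial centre of `𝔰𝔭₄`);
Cartan's criterion. For `𝔤 = Lie Hg` this is the tree's `SymplecticBlocks.isSemisimple_of_eq_hodgeLieC` (Moonen–Zarhin §1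
«if `X` has no factors of Type 4 then `Hg(X)` is semi-simple»). [cite: MoonenZarhin1999LowDim, §3 (3.1) and Lemma (3.4)]
[cite: Deligne1982HodgeCycles, I §3 Prop. 3.4] [cite: Humphreys1972, §5.2] -/
theorem SpBlocksTheta.isSemisimple (H : HodgeStructure V n) (hn : n = 1) (heff : H.IsEffective) (ψ : H.Polarization)
    (hself : ∀ a : H.endAlg, LinearMap.IsAdjointPair ψ.form ψ.form (a : Module.End ℚ V) (a : Module.End ℚ V))
    (σ : ι → (H.endAlg →+* ℂ)) (hreal : ∀ i, (starRingEnd ℂ).comp (σ i) = σ i)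
    (hint : DirectSum.IsInternal fun i => H.eigenBlock (σ i)) (h4 : ∀ i, Module.finrank ℂ (H.eigenBlock (σ i)) = 4)
    (𝔤 : Submodule ℚ (Module.End ℚ V)) (hbr : ∀ X ∈ 𝔤, ∀ X' ∈ 𝔤, X * X' - X' * X ∈ 𝔤) {Θ : Module.End ℂ (ℂ ⊗[ℚ] V)}
    (hΘ : ∀ p, ∀ x ∈ H.piece p (n - p), Θ x = ((2 * p - n : ℤ) : ℂ) • x) (hΘ𝔤 : Θ ∈ spanC 𝔤)
    (hcomm : ∀ X ∈ 𝔤, ∀ a : H.endAlg, X * (a : Module.End ℚ V) = (a : Module.End ℚ V) * X)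
    (hskew : ∀ X ∈ 𝔤, ∀ v w, ψ.form (X v) w + ψ.form v (X w) = 0) :
    letI : LieRing (Module.End ℂ (ℂ ⊗[ℚ] V)) := LieRing.ofAssociativeRing
    ∀ (𝔏 : LieSubalgebra ℂ (Module.End ℂ (ℂ ⊗[ℚ] V))), 𝔏.toSubmodule = spanC 𝔤 → LieAlgebra.IsSemisimple ℂ 𝔏 := by
  letI : LieRing (Module.End ℂ (ℂ ⊗[ℚ] V)) := LieRing.ofAssociativeRing
  intro 𝔏 h𝔏
  haveI := SpBlocksTheta.complementedLattice_lieSubmodule H hn heff ψ 𝔤 hΘ hΘ𝔤 hskew 𝔏 h𝔏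
  haveI : Module.Finite ℂ 𝔏 := Module.Finite.of_injective 𝔏.toSubmodule.subtype Subtype.val_injective
  have hmem : ∀ Y : Module.End ℂ (ℂ ⊗[ℚ] V), Y ∈ spanC 𝔤 ↔ Y ∈ 𝔏 := fun Y => by
    rw [← LieSubalgebra.mem_toSubmodule, h𝔏]
  -- the centre vanishes
  have hcenter : LieAlgebra.center ℂ 𝔏 = ⊥ := by
    rw [eq_bot_iff]
    intro Z hZ
    rw [LieSubmodule.mem_bot]
    have hZc : ∀ Y ∈ spanC 𝔤, Y * (Z : Module.End ℂ (ℂ ⊗[ℚ] V)) - (Z : Module.End ℂ (ℂ ⊗[ℚ] V)) * Y = 0 := by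
      intro Y hY
      have h := (LieModule.mem_maxTrivSubmodule ℂ 𝔏 𝔏 Z).1 hZ ⟨Y, (hmem Y).1 hY⟩
      have h' := congrArg Subtype.val h
      rwa [LieSubalgebra.coe_bracket, LieRing.of_associative_ring_bracket] at h'
    have hZ0 : (Z : Module.End ℂ (ℂ ⊗[ℚ] V)) = 0 := by
      refine LinearMap.ext fun v => ?_
      have hv : v ∈ ⨆ j, H.eigenBlock (σ j) := by
        rw [hint.submodule_iSup_eq_top]
        exact Submodule.mem_top
      rw [LinearMap.zero_apply]
      induction hv using Submodule.iSup_induction' with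
      | mem j x hx =>
        exact SpBlocksTheta.apply_eq_zero_of_forall_commute H hn heff ψ hself σ hreal hint h4 𝔤 hΘ hcomm hskew j (spanC 𝔤)
          (SpBlocksTheta.exists_mem_spanC_restrict_eq H hn heff ψ hself σ hreal hint h4 𝔤 hbr hΘ hΘ𝔤 hcomm hskew j)
          ((hmem _).2 Z.2) (fun Y hY y _ => by rw [hZc Y hY, LinearMap.zero_apply]) hx
      | zero => simp
      | add x y _ _ hx hy => rw [map_add, hx, hy, add_zero]
    exact Subtype.ext hZ0
  exact Literature.Algebra.Lie.isSemisimple_of_complementedLattice_of_center_eq_bot (k := ℂ) (L := 𝔏) (M := ℂ ⊗[ℚ] V) hcenter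

/-! ### §4 The Goursat step: complementary ideals, no intertwiners between distinct blocks, supported lifts -/

/-- **The complementary ideal `N` of `M_i = ker c_i` in the semisimple Lie algebra `𝔤_ℂ`**, as a subspace of `End(V_ℂ)`:
`N ⊆ 𝔤_ℂ` is an ideal, every element of `𝔤_ℂ` agrees on `T_i` with a unique element of `N`, and `[M_i, N] = 0` (Boolean
algebra of ideals of a semisimple Lie algebra, Mathlib; §3). The tree's `SymplecticBlocks.exists_complement_ideal` for an
admissible algebra. [cite: Humphreys1972, §5.2] [cite: MoonenZarhin1999LowDim, §3 (3.1) and Lemma (3.4)] -/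
theorem SpBlocksTheta.exists_complement_ideal (H : HodgeStructure V n) (hn : n = 1) (heff : H.IsEffective)
    (ψ : H.Polarization)
    (hself : ∀ a : H.endAlg, LinearMap.IsAdjointPair ψ.form ψ.form (a : Module.End ℚ V) (a : Module.End ℚ V))
    (σ : ι → (H.endAlg →+* ℂ)) (hreal : ∀ i, (starRingEnd ℂ).comp (σ i) = σ i)
    (hint : DirectSum.IsInternal fun i => H.eigenBlock (σ i)) (h4 : ∀ i, Module.finrank ℂ (H.eigenBlock (σ i)) = 4)
    (𝔤 : Submodule ℚ (Module.End ℚ V)) (hbr : ∀ X ∈ 𝔤, ∀ X' ∈ 𝔤, X * X' - X' * X ∈ 𝔤) {Θ : Module.End ℂ (ℂ ⊗[ℚ] V)}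
    (hΘ : ∀ p, ∀ x ∈ H.piece p (n - p), Θ x = ((2 * p - n : ℤ) : ℂ) • x) (hΘ𝔤 : Θ ∈ spanC 𝔤)
    (hcomm : ∀ X ∈ 𝔤, ∀ a : H.endAlg, X * (a : Module.End ℚ V) = (a : Module.End ℚ V) * X)
    (hskew : ∀ X ∈ 𝔤, ∀ v w, ψ.form (X v) w + ψ.form v (X w) = 0) (i : ι) :
    ∃ N : Submodule ℂ (Module.End ℂ (ℂ ⊗[ℚ] V)), N ≤ spanC 𝔤 ∧
      (∀ W ∈ spanC 𝔤, ∀ Y ∈ N, W * Y - Y * W ∈ N) ∧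
      (∀ W ∈ spanC 𝔤, ∃ Y ∈ N, ∀ x ∈ H.eigenBlock (σ i), W x = Y x) ∧
      (∀ Y ∈ N, (∀ x ∈ H.eigenBlock (σ i), Y x = 0) → Y = 0) ∧
      (∀ m ∈ spanC 𝔤, (∀ x ∈ H.eigenBlock (σ i), m x = 0) → ∀ Y ∈ N, m * Y - Y * m = 0) := by
  classical
  letI : LieRing (Module.End ℂ (ℂ ⊗[ℚ] V)) := LieRing.ofAssociativeRing
  subst hn
  obtain ⟨𝔏, h𝔏⟩ := SpBlocksTheta.exists_lieSubalgebra_eq_spanC (V := V) 𝔤 hbr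
  haveI := SpBlocksTheta.isSemisimple H rfl heff ψ hself σ hreal hint h4 𝔤 hbr hΘ hΘ𝔤 hcomm hskew 𝔏 h𝔏
  have hmem : ∀ Y : Module.End ℂ (ℂ ⊗[ℚ] V), Y ∈ spanC 𝔤 ↔ Y ∈ 𝔏 := fun Y => by
    rw [← LieSubalgebra.mem_toSubmodule, h𝔏]
  have hYT : ∀ Y ∈ spanC 𝔤, ∀ x ∈ H.eigenBlock (σ i), Y x ∈ H.eigenBlock (σ i) :=
    fun Y hY x hx => SpBlocksTheta.apply_mem_eigenBlock H σ hcomm hY i hx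
  have hbr' : ∀ W Y : 𝔏, ((⁅W, Y⁆ : 𝔏) : Module.End ℂ (ℂ ⊗[ℚ] V)) =
      (W : Module.End ℂ (ℂ ⊗[ℚ] V)) * (Y : Module.End ℂ (ℂ ⊗[ℚ] V)) -
        (Y : Module.End ℂ (ℂ ⊗[ℚ] V)) * (W : Module.End ℂ (ℂ ⊗[ℚ] V)) :=
    fun W Y => by rw [LieSubalgebra.coe_bracket, LieRing.of_associative_ring_bracket]
  -- the ideal `M` of elements killing `T_i`, and a complementary ideal `N`
  obtain ⟨M, hmemM⟩ : ∃ M : LieIdeal ℂ 𝔏,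
      ∀ Y : 𝔏, Y ∈ M ↔ ∀ x ∈ H.eigenBlock (σ i), (Y : Module.End ℂ (ℂ ⊗[ℚ] V)) x = 0 :=
    ⟨{ toSubmodule :=
          { carrier := {Y : 𝔏 | ∀ x ∈ H.eigenBlock (σ i), (Y : Module.End ℂ (ℂ ⊗[ℚ] V)) x = 0}
            zero_mem' := fun x _ => by simp
            add_mem' := fun {Y Y'} hY hY' x hx => by
              rw [AddMemClass.coe_add, LinearMap.add_apply, hY x hx, hY' x hx, add_zero]
            smul_mem' := fun c {Y} hY x hx => by
              rw [SetLike.val_smul, LinearMap.smul_apply, hY x hx, smul_zero] },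
        lie_mem := fun {W Y} hY x hx => by
          have hY' : ∀ x ∈ H.eigenBlock (σ i), (Y : Module.End ℂ (ℂ ⊗[ℚ] V)) x = 0 := hY
          rw [hbr', LinearMap.sub_apply, Module.End.mul_apply, Module.End.mul_apply, hY' x hx, map_zero,
            hY' _ (hYT _ ((hmem _).2 W.2) x hx), sub_zero] }, fun Y => Iff.rfl⟩
  obtain ⟨N, hc⟩ : ∃ N : LieIdeal ℂ 𝔏, IsCompl M N := ⟨Mᶜ, isCompl_compl⟩
  have hinf : ∀ Y : 𝔏, Y ∈ M → Y ∈ N → Y = 0 := fun Y h1 h2 => by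
    have h : Y ∈ M ⊓ N := (LieSubmodule.mem_inf M N Y).2 ⟨h1, h2⟩
    rwa [hc.inf_eq_bot, LieSubmodule.mem_bot] at h
  have hsup : ∀ Y : 𝔏, ∃ m ∈ M, ∃ nn ∈ N, m + nn = Y := fun Y => by
    have h : Y ∈ M ⊔ N := by rw [hc.sup_eq_top]; exact LieSubmodule.mem_top Y
    exact (LieSubmodule.mem_sup M N Y).1 h
  refine ⟨N.toSubmodule.map 𝔏.toSubmodule.subtype, ?_, ?_, ?_, ?_, ?_⟩
  · rintro _ ⟨y, -, rfl⟩
    exact (hmem _).2 y.2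
  · rintro W hW _ ⟨y, hy, rfl⟩
    exact ⟨⁅(⟨W, (hmem W).1 hW⟩ : 𝔏), y⁆, N.lie_mem hy, hbr' _ _⟩
  · intro W hW
    obtain ⟨m, hm, nn, hnn, hsum⟩ := hsup ⟨W, (hmem W).1 hW⟩
    refine ⟨nn, ⟨nn, hnn, rfl⟩, fun x hx => ?_⟩
    have h := congrArg (fun Y : 𝔏 => (Y : Module.End ℂ (ℂ ⊗[ℚ] V)) x) hsum
    simp only [AddMemClass.coe_add, LinearMap.add_apply] at h
    rw [(hmemM m).1 hm x hx, zero_add] at h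
    exact h.symm
  · rintro _ ⟨y, hy, rfl⟩ h0
    have h := hinf y ((hmemM y).2 h0) hy
    rw [h]
    exact ZeroMemClass.coe_zero 𝔏
  · rintro m hm hm0 _ ⟨y, hy, rfl⟩
    have hmM : (⟨m, (hmem m).1 hm⟩ : 𝔏) ∈ M := (hmemM _).2 hm0
    have h0 : ⁅(⟨m, (hmem m).1 hm⟩ : 𝔏), y⁆ = 0 :=
      hinf _ (by rw [← lie_skew]; exact M.neg_mem (M.lie_mem hmM)) (N.lie_mem hy)
    have h1 := congrArg (fun Y : 𝔏 => (Y : Module.End ℂ (ℂ ⊗[ℚ] V))) h0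
    simp only [hbr', ZeroMemClass.coe_zero] at h1
    exact h1

omit [HodgeTensorFacts.{u, u}] in
/-- **A `ℂ`-linear `F : T_i → T_j` (`i ≠ j`) intertwining the restrictions of every `X_ℂ`, `X ∈ 𝔤`, vanishes**: its extension by
zero commutes with `𝔤`, hence lies in `E ⊗ ℂ` by descent (`ThetaSubalgebra.eq_zero_of_forall_commute_of_mapsTo_eigenBlock`), which
carries no block into another. The tree's `SymplecticBlocks.eq_zero_of_equivariant` for an admissible algebra.
[cite: MoonenZarhin1999LowDim, §3 (3.1) and Lemma (3.4)] [cite: Hazama1983, §3 (pp. 305–306)] -/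
theorem SpBlocksTheta.eq_zero_of_equivariant (H : HodgeStructure V n) (σ : ι → (H.endAlg →+* ℂ))
    (hint : DirectSum.IsInternal fun i => H.eigenBlock (σ i)) (h4 : ∀ i, Module.finrank ℂ (H.eigenBlock (σ i)) = 4)
    (𝔤 : Submodule ℚ (Module.End ℚ V)) {Θ : Module.End ℂ (ℂ ⊗[ℚ] V)}
    (hΘ : ∀ p, ∀ x ∈ H.piece p (n - p), Θ x = ((2 * p - n : ℤ) : ℂ) • x) (hΘ𝔤 : Θ ∈ spanC 𝔤)
    (hcomm : ∀ X ∈ 𝔤, ∀ a : H.endAlg, X * (a : Module.End ℚ V) = (a : Module.End ℚ V) * X) {i j : ι}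
    (hji : j ≠ i) (F : ↥(H.eigenBlock (σ i)) →ₗ[ℂ] ↥(H.eigenBlock (σ j)))
    (hF : ∀ (X : Module.End ℚ V) (hX : X ∈ 𝔤) (x : H.eigenBlock (σ i)),
      ((F ⟨X.baseChange ℂ x, SpBlocksTheta.apply_mem_eigenBlock H σ hcomm (baseChange_mem_spanC hX) i x.2⟩ :
        H.eigenBlock (σ j)) : ℂ ⊗[ℚ] V) = X.baseChange ℂ ((F x : H.eigenBlock (σ j)) : ℂ ⊗[ℚ] V)) : F = 0 := by
  classical
  have hYT : ∀ X ∈ 𝔤, ∀ k, ∀ x ∈ H.eigenBlock (σ k), X.baseChange ℂ x ∈ H.eigenBlock (σ k) :=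
    fun X hX k x hx => SpBlocksTheta.apply_mem_eigenBlock H σ hcomm (baseChange_mem_spanC hX) k hx
  have hdisj : Disjoint (H.eigenBlock (σ i)) (⨆ (k) (_ : k ≠ i), H.eigenBlock (σ k)) := iSupIndep_def.1 hint.submodule_iSupIndep i
  have hcod : H.eigenBlock (σ i) ⊔ (⨆ (k) (_ : k ≠ i), H.eigenBlock (σ k)) = ⊤ := by
    rw [← hint.submodule_iSup_eq_top, iSup_split_single (fun k => H.eigenBlock (σ k)) i]
  have hcT : IsCompl (H.eigenBlock (σ i)) (⨆ (k) (_ : k ≠ i), H.eigenBlock (σ k)) := ⟨hdisj, codisjoint_iff.2 hcod⟩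
  obtain ⟨Zx, hZx_left, hZx_right⟩ : ∃ Zx : Module.End ℂ (ℂ ⊗[ℚ] V),
      (∀ x (hx : x ∈ H.eigenBlock (σ i)), Zx x = F ⟨x, hx⟩) ∧ ∀ x ∈ (⨆ (k) (_ : k ≠ i), H.eigenBlock (σ k)), Zx x = 0 :=
    ⟨(H.eigenBlock (σ j)).subtype ∘ₗ F ∘ₗ (H.eigenBlock (σ i)).projectionOnto _ hcT,
      fun x hx => by
        rw [LinearMap.comp_apply, LinearMap.comp_apply, Submodule.projectionOnto_apply_of_mem_left hcT hx, Submodule.coe_subtype],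
      fun x hx => by
        rw [LinearMap.comp_apply, LinearMap.comp_apply, Submodule.projectionOnto_apply_of_mem_right hcT hx, map_zero, map_zero]⟩
  have hCstab : ∀ X ∈ 𝔤, ∀ x ∈ (⨆ (k) (_ : k ≠ i), H.eigenBlock (σ k)),
      X.baseChange ℂ x ∈ (⨆ (k) (_ : k ≠ i), H.eigenBlock (σ k)) := by
    intro X hX x hx
    have hle : (⨆ (k) (_ : k ≠ i), H.eigenBlock (σ k)) ≤ Submodule.comap (X.baseChange ℂ) (⨆ (k) (_ : k ≠ i), H.eigenBlock (σ k)) := by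
      refine iSup₂_le fun k hk y hy => ?_
      rw [Submodule.mem_comap]
      exact Submodule.mem_iSup_of_mem (p := fun k => ⨆ (_ : k ≠ i), H.eigenBlock (σ k)) k
        (Submodule.mem_iSup_of_mem (p := fun _ : k ≠ i => H.eigenBlock (σ k)) hk (hYT X hX k y hy))
    exact hle hx
  have hc' : ∀ X ∈ 𝔤, Zx * X.baseChange ℂ = X.baseChange ℂ * Zx := by
    intro X hX
    refine LinearMap.ext fun v => ?_
    obtain ⟨a, ha, c, hcC, rfl⟩ := Submodule.mem_sup.1 (show v ∈ H.eigenBlock (σ i) ⊔ (⨆ (k) (_ : k ≠ i), H.eigenBlock (σ k)) by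
      rw [hcod]; exact Submodule.mem_top)
    rw [Module.End.mul_apply, Module.End.mul_apply, map_add, map_add, map_add, map_add, hZx_right c hcC, map_zero, add_zero,
      hZx_right _ (hCstab X hX c hcC), add_zero, hZx_left a ha, hZx_left _ (hYT X hX i a ha)]
    exact hF X hX ⟨a, ha⟩
  have hσ : σ i ≠ σ j := by
    intro h
    have hd : Disjoint (H.eigenBlock (σ i)) (H.eigenBlock (σ j)) := hint.submodule_iSupIndep.pairwiseDisjoint (Ne.symm hji)
    rw [← h, disjoint_self] at hd
    have h4i := h4 i
    rw [hd, finrank_bot] at h4i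
    exact absurd h4i (by norm_num)
  refine LinearMap.ext fun x => Subtype.ext ?_
  rw [LinearMap.zero_apply, Submodule.coe_zero, ← hZx_left x.1 x.2]
  exact ThetaSubalgebra.eq_zero_of_forall_commute_of_mapsTo_eigenBlock H 𝔤 hΘ hΘ𝔤 hσ hc'
    (fun y hy => by rw [hZx_left y hy]; exact (F ⟨y, hy⟩).2) x.2

/-- **THE GOURSAT STEP for an admissible algebra (Moonen–Zarhin (3.1)/(3.4) for the rigid factor `𝔰𝔭(T_i)`).** In the
four-dimensional real-block situation, for every admissible `𝔤`, every block `T_i` and every `ψ_ℂ|_{T_i}`-skew `ℂ`-linear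
`g : T_i → T_i` there is `Y ∈ 𝔤_ℂ` with `Y|_{T_i} = g` and `Y|_{T_j} = 0` for all `j ≠ i`. Proof as in the tree's
`SymplecticBlocks.exists_mem_hodgeLieC_supported`: the ideal `N` complementary to `ker c_i` (§4) is supported on `T_i`, for
if it moved another block `T_j` then `c_j` would be injective on `N ≅ 𝔰𝔭(T_i)` and `ρ = c_j ∘ (c_i|_N)⁻¹` a bracket-preserving
injection `𝔰𝔭(T_i) → End(T_j)` intertwining `ad Θ`; the witness theorem `SymplecticWitness.exists_equivariant_ne_zero` (the
standard representation is the only length-one representation of `𝔰𝔭`) gives a non-zero equivariant `T_i → T_j`, which §4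
forbids. [cite: MoonenZarhin1999LowDim, §3 (3.1) and Lemma (3.4)] [cite: MoonenZarhin1995Duke, Type I(2)]
[cite: Hazama1983, §3 (pp. 305–306)] -/
theorem SpBlocksTheta.exists_mem_spanC_supported (H : HodgeStructure V n) (hn : n = 1) (heff : H.IsEffective)
    (ψ : H.Polarization)
    (hself : ∀ a : H.endAlg, LinearMap.IsAdjointPair ψ.form ψ.form (a : Module.End ℚ V) (a : Module.End ℚ V))
    (σ : ι → (H.endAlg →+* ℂ)) (hreal : ∀ i, (starRingEnd ℂ).comp (σ i) = σ i)
    (hint : DirectSum.IsInternal fun i => H.eigenBlock (σ i)) (h4 : ∀ i, Module.finrank ℂ (H.eigenBlock (σ i)) = 4)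
    (𝔤 : Submodule ℚ (Module.End ℚ V)) (hbr : ∀ X ∈ 𝔤, ∀ X' ∈ 𝔤, X * X' - X' * X ∈ 𝔤) {Θ : Module.End ℂ (ℂ ⊗[ℚ] V)}
    (hΘ : ∀ p, ∀ x ∈ H.piece p (n - p), Θ x = ((2 * p - n : ℤ) : ℂ) • x) (hΘ𝔤 : Θ ∈ spanC 𝔤)
    (hcomm : ∀ X ∈ 𝔤, ∀ a : H.endAlg, X * (a : Module.End ℚ V) = (a : Module.End ℚ V) * X)
    (hskew : ∀ X ∈ 𝔤, ∀ v w, ψ.form (X v) w + ψ.form v (X w) = 0) (i : ι) :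
    ∀ g : Module.End ℂ ↥(H.eigenBlock (σ i)),
      (∀ x y : H.eigenBlock (σ i), ψ.form.baseChange ℂ ((g x : H.eigenBlock (σ i)) : ℂ ⊗[ℚ] V) y +
        ψ.form.baseChange ℂ (x : ℂ ⊗[ℚ] V) ((g y : H.eigenBlock (σ i)) : ℂ ⊗[ℚ] V) = 0) →
      ∃ Y ∈ spanC 𝔤, (∀ x : H.eigenBlock (σ i), ((g x : H.eigenBlock (σ i)) : ℂ ⊗[ℚ] V) = Y x) ∧
        ∀ j, j ≠ i → ∀ x ∈ H.eigenBlock (σ j), Y x = 0 := by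
  classical
  subst hn
  have hYT : ∀ Y ∈ spanC 𝔤, ∀ k, ∀ x ∈ H.eigenBlock (σ k), Y x ∈ H.eigenBlock (σ k) :=
    fun Y hY k x hx => SpBlocksTheta.apply_mem_eigenBlock H σ hcomm hY k hx
  have hYskew : ∀ Y ∈ spanC 𝔤, ∀ x y, ψ.form.baseChange ℂ (Y x) y + ψ.form.baseChange ℂ x (Y y) = 0 :=
    fun Y hY => ThetaSubalgebra.formBaseChange_add_eq_zero_of_mem_spanC ψ hskew hY
  obtain ⟨N', hN'le, hN'ideal, hN'dec, hN'uniq, hMN⟩ :=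
    SpBlocksTheta.exists_complement_ideal H rfl heff ψ hself σ hreal hint h4 𝔤 hbr hΘ hΘ𝔤 hcomm hskew i
  -- lifting a skew operator on `T_i` into `N'`
  have hliftN : ∀ g' : Module.End ℂ ↥(H.eigenBlock (σ i)),
      (∀ x y : H.eigenBlock (σ i), ψ.form.baseChange ℂ ((g' x : H.eigenBlock (σ i)) : ℂ ⊗[ℚ] V) y +
        ψ.form.baseChange ℂ (x : ℂ ⊗[ℚ] V) ((g' y : H.eigenBlock (σ i)) : ℂ ⊗[ℚ] V) = 0) →
      ∃ Y ∈ N', ∀ x : H.eigenBlock (σ i), ((g' x : H.eigenBlock (σ i)) : ℂ ⊗[ℚ] V) = Y x := by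
    intro g' hg'
    obtain ⟨W, hW, hWg⟩ := SpBlocksTheta.exists_mem_spanC_restrict_eq H rfl heff ψ hself σ hreal hint h4 𝔤 hbr hΘ hΘ𝔤 hcomm
      hskew i g' hg'
    obtain ⟨Y, hY, hWY⟩ := hN'dec W hW
    exact ⟨Y, hY, fun x => by rw [hWg x, hWY _ x.2]⟩
  have huniqN : ∀ Y Y', Y ∈ N' → Y' ∈ N' → (∀ x ∈ H.eigenBlock (σ i), Y x = Y' x) → Y = Y' :=
    fun Y Y' hY hY' h => sub_eq_zero.1 (hN'uniq _ (N'.sub_mem hY hY') fun x hx => by rw [LinearMap.sub_apply, h x hx, sub_self])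
  intro g hg
  -- either `N'` is supported on `T_i` (done), or it moves some other block `T_j` (impossible)
  by_cases hsupp : ∀ j, j ≠ i → ∀ Y ∈ N', ∀ x ∈ H.eigenBlock (σ j), Y x = 0
  · obtain ⟨Y, hY, hg'⟩ := hliftN g hg
    exact ⟨Y, hN'le hY, hg', fun j hj x hx => hsupp j hj Y hY x hx⟩
  exfalso
  push Not at hsupp
  obtain ⟨j, hji, Y₀, hY₀, x₀, hx₀, hY₀x₀⟩ := hsupp
  -- `N'` restricts onto `𝔰𝔭(T_j)`, `M` kills `T_j`, and `c_j` is injective on `N'`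
  have hNonto := (SpBlocksTheta.restrict_ideal_dichotomy H rfl heff ψ hself σ hreal hint h4 𝔤 hbr hΘ hΘ𝔤 hcomm hskew N' hN'le
    hN'ideal j).resolve_left (fun h => hY₀x₀ (h Y₀ hY₀ x₀ hx₀))
  have hMj : ∀ m ∈ spanC 𝔤, (∀ x ∈ H.eigenBlock (σ i), m x = 0) → ∀ x ∈ H.eigenBlock (σ j), m x = 0 :=
    fun m hm hm0 x hx => SpBlocksTheta.apply_eq_zero_of_forall_commute H rfl heff ψ hself σ hreal hint h4 𝔤 hΘ hcomm hskew j N'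
      hNonto hm (fun Y hY y _ => by
        have h := hMN m hm hm0 Y hY
        rw [← neg_sub, h, neg_zero, LinearMap.zero_apply]) hx
  have hinjN : ∀ Y ∈ N', (∀ x ∈ H.eigenBlock (σ j), Y x = 0) → Y = 0 := by
    -- the ideal `K = N' ∩ ker c_j`
    obtain ⟨K, hmemK⟩ : ∃ K : Submodule ℂ (Module.End ℂ (ℂ ⊗[ℚ] V)), ∀ Y, Y ∈ K ↔ Y ∈ N' ∧ ∀ x ∈ H.eigenBlock (σ j), Y x = 0 :=
      ⟨{ carrier := {Y | Y ∈ N' ∧ ∀ x ∈ H.eigenBlock (σ j), Y x = 0}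
         zero_mem' := ⟨N'.zero_mem, fun x _ => by simp⟩
         add_mem' := fun {Y Y'} hY hY' => ⟨N'.add_mem hY.1 hY'.1, fun x hx => by
           rw [LinearMap.add_apply, hY.2 x hx, hY'.2 x hx, add_zero]⟩
         smul_mem' := fun c {Y} hY => ⟨N'.smul_mem c hY.1, fun x hx => by rw [LinearMap.smul_apply, hY.2 x hx, smul_zero]⟩ },
        fun Y => Iff.rfl⟩
    have hKle : K ≤ spanC 𝔤 := fun Y hY => hN'le ((hmemK Y).1 hY).1
    have hKideal : ∀ W ∈ spanC 𝔤, ∀ Y ∈ K, W * Y - Y * W ∈ K := fun W hW Y hY =>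
      (hmemK _).2 ⟨hN'ideal W hW Y ((hmemK Y).1 hY).1, fun x hx => by
        rw [LinearMap.sub_apply, Module.End.mul_apply, Module.End.mul_apply, ((hmemK Y).1 hY).2 x hx, map_zero,
          ((hmemK Y).1 hY).2 _ (hYT W hW j x hx), sub_zero]⟩
    rcases SpBlocksTheta.restrict_ideal_dichotomy H rfl heff ψ hself σ hreal hint h4 𝔤 hbr hΘ hΘ𝔤 hcomm hskew K hKle hKideal i
      with hK | hK
    · exact fun Y hY hYj => hN'uniq Y hY (hK Y ((hmemK Y).2 ⟨hY, hYj⟩))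
    · exfalso
      apply hY₀x₀
      have hskew' : ∀ x y : H.eigenBlock (σ i),
          ψ.form.baseChange ℂ (((Y₀.restrict fun x hx => hYT _ (hN'le hY₀) i x hx) x : H.eigenBlock (σ i)) : ℂ ⊗[ℚ] V) y +
            ψ.form.baseChange ℂ (x : ℂ ⊗[ℚ] V) (((Y₀.restrict fun x hx => hYT _ (hN'le hY₀) i x hx) y : H.eigenBlock (σ i)) :
              ℂ ⊗[ℚ] V) = 0 := fun x y => by
        rw [LinearMap.coe_restrict_apply, LinearMap.coe_restrict_apply]
        exact hYskew _ (hN'le hY₀) _ _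
      obtain ⟨Yk, hYk, hYk'⟩ := hK _ hskew'
      have hyk : Y₀ = Yk := huniqN Y₀ Yk hY₀ ((hmemK Yk).1 hYk).1 fun x hx => by
        have h := hYk' ⟨x, hx⟩
        rwa [LinearMap.coe_restrict_apply] at h
      rw [hyk]
      exact ((hmemK Yk).1 hYk).2 x₀ hx₀
  -- block data on `T_i` and `T_j`
  obtain ⟨hωnd, hωalt, TΘ, P, Q, hTΘ, hTT, hTskew, hP, hQ, hPmem, hQmem, hP2, hQ2⟩ :=
    SymplecticBlocks.exists_blockData H rfl heff ψ hself σ hreal hint h4 hΘ i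
  obtain ⟨-, -, TΘj, -, -, hTΘj, hTTj, -⟩ := SymplecticBlocks.exists_blockData H rfl heff ψ hself σ hreal hint h4 hΘ j
  set ω : LinearMap.BilinForm ℂ ↥(H.eigenBlock (σ i)) :=
    (ψ.form.baseChange ℂ).compl₁₂ (H.eigenBlock (σ i)).subtype (H.eigenBlock (σ i)).subtype with hω
  have hω_apply : ∀ x y : H.eigenBlock (σ i), ω x y = ψ.form.baseChange ℂ (x : ℂ ⊗[ℚ] V) y := fun x y => rfl
  clear_value ω
  have hP0 : P ≠ ⊥ := by
    intro h
    rw [h, finrank_bot] at hP2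
    exact absurd hP2 (by norm_num)
  -- the skew operators on `T_i`
  obtain ⟨𝔰, hmem𝔰⟩ : ∃ 𝔰 : Submodule ℂ (Module.End ℂ ↥(H.eigenBlock (σ i))),
      ∀ Z, Z ∈ 𝔰 ↔ ∀ x y : H.eigenBlock (σ i), ω (Z x) y + ω x (Z y) = 0 :=
    ⟨{ carrier := {Z | ∀ x y : H.eigenBlock (σ i), ω (Z x) y + ω x (Z y) = 0}
       zero_mem' := fun x y => by simp
       add_mem' := by
         intro Z Z' hZ hZ' x y
         simp only [LinearMap.add_apply, map_add]
         have h1 := hZ x y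
         have h2 := hZ' x y
         linear_combination h1 + h2
       smul_mem' := by
         intro c Z hZ x y
         simp only [LinearMap.smul_apply, map_smul, smul_eq_mul]
         have h1 := hZ x y
         linear_combination c * h1 }, fun Z => Iff.rfl⟩
  -- the lift `𝔰 → N'` and the transport `ρ : End(T_i) → End(T_j)`
  have hlift : ∀ Z : 𝔰, ∃ Y, Y ∈ N' ∧
      ∀ x : H.eigenBlock (σ i), ((((Z : Module.End ℂ ↥(H.eigenBlock (σ i))) x) : H.eigenBlock (σ i)) : ℂ ⊗[ℚ] V) = Y x :=
    fun Z => hliftN Z fun x y => by rw [← hω_apply, ← hω_apply]; exact (hmem𝔰 _).1 Z.2 x y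
  choose lift hliftN_mem hlift_eq using hlift
  have hlift_eq' : ∀ (Z : Module.End ℂ ↥(H.eigenBlock (σ i))) (hZ : Z ∈ 𝔰) (x : H.eigenBlock (σ i)),
      ((Z x : H.eigenBlock (σ i)) : ℂ ⊗[ℚ] V) = lift ⟨Z, hZ⟩ x := fun Z hZ x => hlift_eq ⟨Z, hZ⟩ x
  have hlift_unique : ∀ (Z : 𝔰) (Y : Module.End ℂ (ℂ ⊗[ℚ] V)), Y ∈ N' →
      (∀ x : H.eigenBlock (σ i), ((((Z : Module.End ℂ ↥(H.eigenBlock (σ i))) x) : H.eigenBlock (σ i)) : ℂ ⊗[ℚ] V) = Y x) →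
      lift Z = Y :=
    fun Z Y hY h => huniqN _ _ (hliftN_mem Z) hY fun x hx => by rw [← hlift_eq Z ⟨x, hx⟩, h ⟨x, hx⟩]
  have hlift_add : ∀ Z Z' : 𝔰, lift (Z + Z') = lift Z + lift Z' :=
    fun Z Z' => hlift_unique _ _ (N'.add_mem (hliftN_mem Z) (hliftN_mem Z')) fun x => by
      rw [Submodule.coe_add, LinearMap.add_apply, Submodule.coe_add, hlift_eq, hlift_eq, LinearMap.add_apply]
  have hlift_smul : ∀ (c : ℂ) (Z : 𝔰), lift (c • Z) = c • lift Z :=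
    fun c Z => hlift_unique _ _ (N'.smul_mem c (hliftN_mem Z)) fun x => by
      rw [Submodule.coe_smul, LinearMap.smul_apply, Submodule.coe_smul, hlift_eq, LinearMap.smul_apply]
  have hliftTj : ∀ Z : 𝔰, ∀ x ∈ H.eigenBlock (σ j), lift Z x ∈ H.eigenBlock (σ j) :=
    fun Z x hx => hYT _ (hN'le (hliftN_mem Z)) j x hx
  obtain ⟨ρ₀, hρ₀⟩ : ∃ ρ₀ : 𝔰 →ₗ[ℂ] Module.End ℂ ↥(H.eigenBlock (σ j)), ∀ (Z : 𝔰) (x : H.eigenBlock (σ j)),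
      ((ρ₀ Z x : H.eigenBlock (σ j)) : ℂ ⊗[ℚ] V) = lift Z x :=
    ⟨{ toFun := fun Z => (lift Z).restrict (hliftTj Z)
       map_add' := fun Z Z' => LinearMap.ext fun x => Subtype.ext (by
         simp only [LinearMap.coe_restrict_apply, LinearMap.add_apply, hlift_add, Submodule.coe_add])
       map_smul' := fun c Z => LinearMap.ext fun x => Subtype.ext (by
         simp only [LinearMap.coe_restrict_apply, LinearMap.smul_apply, hlift_smul, Submodule.coe_smul, RingHom.id_apply]) },
      fun Z x => rfl⟩
  obtain ⟨C, hC⟩ := Submodule.exists_isCompl (K := ℂ) (V := Module.End ℂ ↥(H.eigenBlock (σ i))) 𝔰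
  obtain ⟨π𝔰, hπ𝔰⟩ : ∃ π𝔰 : Module.End ℂ ↥(H.eigenBlock (σ i)) →ₗ[ℂ] ↥𝔰, ∀ Z (hZ : Z ∈ 𝔰), π𝔰 Z = ⟨Z, hZ⟩ :=
    ⟨Submodule.projectionOnto (R := ℂ) (E := Module.End ℂ ↥(H.eigenBlock (σ i))) 𝔰 C hC, fun Z hZ =>
      Submodule.projectionOnto_apply_of_mem_left hC hZ⟩
  obtain ⟨ρ, hρ⟩ : ∃ ρ : Module.End ℂ ↥(H.eigenBlock (σ i)) →ₗ[ℂ] Module.End ℂ ↥(H.eigenBlock (σ j)),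
      ∀ Z (hZ : Z ∈ 𝔰) (x : H.eigenBlock (σ j)), ((ρ Z x : H.eigenBlock (σ j)) : ℂ ⊗[ℚ] V) = lift ⟨Z, hZ⟩ x :=
    ⟨ρ₀ ∘ₗ π𝔰, fun Z hZ x => by rw [LinearMap.comp_apply, hπ𝔰 Z hZ, hρ₀]⟩
  -- `ρ` on the restriction of an element of `𝔤_ℂ`: it is the `T_j`-restriction of the same element
  have hskew𝔰 : ∀ (W : Module.End ℂ (ℂ ⊗[ℚ] V)) (hW : W ∈ spanC 𝔤), W.restrict (fun x hx => hYT W hW i x hx) ∈ 𝔰 :=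
    fun W hW => (hmem𝔰 _).2 fun x y => by
      rw [hω_apply, hω_apply, LinearMap.coe_restrict_apply, LinearMap.coe_restrict_apply]
      exact hYskew W hW _ _
  have hρ_restrict : ∀ (W : Module.End ℂ (ℂ ⊗[ℚ] V)) (hW : W ∈ spanC 𝔤) (x : H.eigenBlock (σ j)),
      ((ρ (W.restrict fun x hx => hYT W hW i x hx) x : H.eigenBlock (σ j)) : ℂ ⊗[ℚ] V) = W x := by
    intro W hW x
    obtain ⟨Y, hY, hWY⟩ := hN'dec W hW
    have hl : lift ⟨_, hskew𝔰 W hW⟩ = Y := hlift_unique _ Y hY fun y => by rw [LinearMap.coe_restrict_apply, hWY _ y.2]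
    have hWYj : ∀ y ∈ H.eigenBlock (σ j), (W - Y) y = 0 :=
      hMj (W - Y) (Submodule.sub_mem _ hW (hN'le hY)) fun y hy => by rw [LinearMap.sub_apply, hWY y hy, sub_self]
    have h := hWYj x x.2
    rw [LinearMap.sub_apply, sub_eq_zero] at h
    rw [hρ _ (hskew𝔰 W hW), hl, h]
  -- hypotheses of the witness theorem
  have hρbr : ∀ Z ∈ 𝔰, ∀ Z' ∈ 𝔰, ρ (Z * Z' - Z' * Z) = ρ Z * ρ Z' - ρ Z' * ρ Z := by
    intro Z hZ Z' hZ'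
    have h𝔰br : Z * Z' - Z' * Z ∈ 𝔰 := (hmem𝔰 _).2 fun x y => by
      simp only [LinearMap.sub_apply, Module.End.mul_apply, map_sub, LinearMap.sub_apply]
      have h1 := (hmem𝔰 Z).1 hZ (Z' x) y
      have h2 := (hmem𝔰 Z').1 hZ' x (Z y)
      have h3 := (hmem𝔰 Z').1 hZ' (Z x) y
      have h4 := (hmem𝔰 Z).1 hZ x (Z' y)
      linear_combination h1 - h3 + h4 - h2
    have hl : lift ⟨_, h𝔰br⟩ = lift ⟨Z, hZ⟩ * lift ⟨Z', hZ'⟩ - lift ⟨Z', hZ'⟩ * lift ⟨Z, hZ⟩ :=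
      hlift_unique _ _ (hN'ideal _ (hN'le (hliftN_mem _)) _ (hliftN_mem _)) fun x => by
        change (((Z * Z' - Z' * Z) x : H.eigenBlock (σ i)) : ℂ ⊗[ℚ] V) = _
        rw [LinearMap.sub_apply, Submodule.coe_sub, Module.End.mul_apply, Module.End.mul_apply, hlift_eq' Z hZ, hlift_eq' Z' hZ',
          hlift_eq' Z' hZ', hlift_eq' Z hZ, LinearMap.sub_apply, Module.End.mul_apply, Module.End.mul_apply]
    refine LinearMap.ext fun x => Subtype.ext ?_
    rw [hρ _ h𝔰br, hl]
    simp only [LinearMap.sub_apply, Submodule.coe_sub, Module.End.mul_apply, hρ _ hZ, hρ _ hZ']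
  have hTΘ𝔰 : TΘ ∈ 𝔰 := (hmem𝔰 _).2 hTskew
  have hρTΘ : ρ TΘ = TΘj := by
    have h := hρ_restrict Θ hΘ𝔤
    have hres : Θ.restrict (fun x hx => hYT Θ hΘ𝔤 i x hx) = TΘ :=
      LinearMap.ext fun x => Subtype.ext (by rw [LinearMap.coe_restrict_apply, hTΘ])
    rw [hres] at h
    exact LinearMap.ext fun x => Subtype.ext (by rw [h, hTΘj])
  have hρΘ : ∀ Z ∈ 𝔰, ρ (TΘ * Z - Z * TΘ) = TΘj * ρ Z - ρ Z * TΘj := fun Z hZ => by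
    rw [hρbr TΘ hTΘ𝔰 Z hZ, hρTΘ]
  have hinjρ : ∀ Z ∈ 𝔰, ρ Z = 0 → Z = 0 := by
    intro Z hZ h0
    have hl0 : lift ⟨Z, hZ⟩ = 0 := hinjN _ (hliftN_mem _) fun x hx => by
      have h := congrArg (fun f : Module.End ℂ ↥(H.eigenBlock (σ j)) => ((f ⟨x, hx⟩ : H.eigenBlock (σ j)) : ℂ ⊗[ℚ] V)) h0
      simp only [LinearMap.zero_apply, Submodule.coe_zero] at h
      rw [← h, hρ _ hZ]
    refine LinearMap.ext fun x => Subtype.ext ?_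
    rw [hlift_eq' Z hZ, hl0, LinearMap.zero_apply, LinearMap.zero_apply, Submodule.coe_zero]
  -- the witness: a non-zero `ρ`-equivariant `F : T_i → T_j` — which must vanish
  obtain ⟨F, hF0, hF⟩ := SymplecticWitness.exists_equivariant_ne_zero ω hωnd hωalt hTT hTskew hP hQ hPmem hQmem hP0 𝔰 hmem𝔰 hTTj ρ
    hρbr hρΘ hinjρ
  refine hF0 (SpBlocksTheta.eq_zero_of_equivariant H σ hint h4 𝔤 hΘ hΘ𝔤 hcomm hji F fun X hX x => ?_)
  have hW : X.baseChange ℂ ∈ spanC 𝔤 := baseChange_mem_spanC hX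
  have h := congrArg (fun f : ↥(H.eigenBlock (σ i)) →ₗ[ℂ] ↥(H.eigenBlock (σ j)) => ((f x : H.eigenBlock (σ j)) : ℂ ⊗[ℚ] V))
    (hF _ (hskew𝔰 _ hW))
  simp only [LinearMap.comp_apply] at h
  rw [hρ_restrict _ hW] at h
  exact h.symm

/-! ### §5 `𝔤_ℂ = ⊕_i 𝔰𝔭(T_i)`, uniqueness `𝔤 = Lie Hg(H)`, and Theorem L in the word model -/

/-- **`𝔤_ℂ ⊇ ⊕_i 𝔰𝔭(T_i)`: every block-preserving `ψ_ℂ`-skew operator lies in `𝔤_ℂ`** (sum of the supported lifts of its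
restrictions, §4). With the converse (§0) this is `𝔤_ℂ = 𝔰𝔭_E(V, ψ)_ℂ = ⊕_i 𝔰𝔭(T_i, ψ_ℂ|_{T_i})` — Moonen–Zarhin 1995 Type I(2)
«`Hg(X) = R_{F/ℚ} Sp_F(V, ψ)`» in Lie form, for EVERY admissible rational algebra (Deligne's minimality).
[cite: MoonenZarhin1995Duke, Type I(2)] [cite: MoonenZarhin1999LowDim, §3 (3.1) and Lemma (3.4)] [cite: Deligne1982HodgeCycles, I §3 Prop. 3.4] -/
theorem SpBlocksTheta.mem_spanC_of_mapsTo_of_skew [Fintype ι] (H : HodgeStructure V n) (hn : n = 1) (heff : H.IsEffective)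
    (ψ : H.Polarization)
    (hself : ∀ a : H.endAlg, LinearMap.IsAdjointPair ψ.form ψ.form (a : Module.End ℚ V) (a : Module.End ℚ V))
    (σ : ι → (H.endAlg →+* ℂ)) (hreal : ∀ i, (starRingEnd ℂ).comp (σ i) = σ i)
    (hint : DirectSum.IsInternal fun i => H.eigenBlock (σ i)) (h4 : ∀ i, Module.finrank ℂ (H.eigenBlock (σ i)) = 4)
    (𝔤 : Submodule ℚ (Module.End ℚ V)) (hbr : ∀ X ∈ 𝔤, ∀ X' ∈ 𝔤, X * X' - X' * X ∈ 𝔤) {Θ : Module.End ℂ (ℂ ⊗[ℚ] V)}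
    (hΘ : ∀ p, ∀ x ∈ H.piece p (n - p), Θ x = ((2 * p - n : ℤ) : ℂ) • x) (hΘ𝔤 : Θ ∈ spanC 𝔤)
    (hcomm : ∀ X ∈ 𝔤, ∀ a : H.endAlg, X * (a : Module.End ℚ V) = (a : Module.End ℚ V) * X)
    (hskew : ∀ X ∈ 𝔤, ∀ v w, ψ.form (X v) w + ψ.form v (X w) = 0) {Y : Module.End ℂ (ℂ ⊗[ℚ] V)}
    (hYT : ∀ i, Set.MapsTo Y (H.eigenBlock (σ i)) (H.eigenBlock (σ i)))
    (hYskew : ∀ x y, ψ.form.baseChange ℂ (Y x) y + ψ.form.baseChange ℂ x (Y y) = 0) : Y ∈ spanC 𝔤 := by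
  classical
  have hsk : ∀ i, ∀ x y : H.eigenBlock (σ i),
      ψ.form.baseChange ℂ (((Y.restrict fun x hx => hYT i hx) x : H.eigenBlock (σ i)) : ℂ ⊗[ℚ] V) y +
        ψ.form.baseChange ℂ (x : ℂ ⊗[ℚ] V) (((Y.restrict fun x hx => hYT i hx) y : H.eigenBlock (σ i)) : ℂ ⊗[ℚ] V) = 0 :=
    fun i x y => by rw [LinearMap.coe_restrict_apply, LinearMap.coe_restrict_apply]; exact hYskew _ _
  choose L hLmem hLeq hLzero using fun i =>
    SpBlocksTheta.exists_mem_spanC_supported H hn heff ψ hself σ hreal hint h4 𝔤 hbr hΘ hΘ𝔤 hcomm hskew i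
      (Y.restrict fun x hx => hYT i hx) (hsk i)
  have hsum : Y = ∑ i, L i := by
    refine LinearMap.ext fun v => ?_
    have hv : v ∈ ⨆ j, H.eigenBlock (σ j) := by
      rw [hint.submodule_iSup_eq_top]
      exact Submodule.mem_top
    induction hv using Submodule.iSup_induction' with
    | mem j x hx =>
      rw [LinearMap.sum_apply, Finset.sum_eq_single j (fun i _ hij => hLzero i j (Ne.symm hij) x hx)
        (fun h => absurd (Finset.mem_univ j) h)]
      have h := hLeq j ⟨x, hx⟩
      rwa [LinearMap.coe_restrict_apply] at h
    | zero => simp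
    | add x y _ _ hx hy => rw [map_add, map_add, hx, hy]
  rw [hsum]
  exact Submodule.sum_mem _ fun i _ => hLmem i

/-- **`𝔤_ℂ = 𝔰𝔭_E(V, ψ)_ℂ`, block form**: `Y ∈ 𝔤_ℂ` iff `Y` preserves every block and is `ψ_ℂ`-skew.
[cite: MoonenZarhin1995Duke, Type I(2)] [cite: Hazama1983, §3 (pp. 305–306)] -/
theorem SpBlocksTheta.mem_spanC_iff_mapsTo_and_skew [Fintype ι] (H : HodgeStructure V n) (hn : n = 1) (heff : H.IsEffective)
    (ψ : H.Polarization)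
    (hself : ∀ a : H.endAlg, LinearMap.IsAdjointPair ψ.form ψ.form (a : Module.End ℚ V) (a : Module.End ℚ V))
    (σ : ι → (H.endAlg →+* ℂ)) (hreal : ∀ i, (starRingEnd ℂ).comp (σ i) = σ i)
    (hint : DirectSum.IsInternal fun i => H.eigenBlock (σ i)) (h4 : ∀ i, Module.finrank ℂ (H.eigenBlock (σ i)) = 4)
    (𝔤 : Submodule ℚ (Module.End ℚ V)) (hbr : ∀ X ∈ 𝔤, ∀ X' ∈ 𝔤, X * X' - X' * X ∈ 𝔤) {Θ : Module.End ℂ (ℂ ⊗[ℚ] V)}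
    (hΘ : ∀ p, ∀ x ∈ H.piece p (n - p), Θ x = ((2 * p - n : ℤ) : ℂ) • x) (hΘ𝔤 : Θ ∈ spanC 𝔤)
    (hcomm : ∀ X ∈ 𝔤, ∀ a : H.endAlg, X * (a : Module.End ℚ V) = (a : Module.End ℚ V) * X)
    (hskew : ∀ X ∈ 𝔤, ∀ v w, ψ.form (X v) w + ψ.form v (X w) = 0) (Y : Module.End ℂ (ℂ ⊗[ℚ] V)) :
    Y ∈ spanC 𝔤 ↔
      (∀ i, Set.MapsTo Y (H.eigenBlock (σ i)) (H.eigenBlock (σ i))) ∧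
      (∀ x y, ψ.form.baseChange ℂ (Y x) y + ψ.form.baseChange ℂ x (Y y) = 0) :=
  ⟨fun hY => ⟨fun i => fun _ hx => SpBlocksTheta.apply_mem_eigenBlock H σ hcomm hY i hx,
      ThetaSubalgebra.formBaseChange_add_eq_zero_of_mem_spanC ψ hskew hY⟩,
    fun ⟨hT, hs⟩ => SpBlocksTheta.mem_spanC_of_mapsTo_of_skew H hn heff ψ hself σ hreal hint h4 𝔤 hbr hΘ hΘ𝔤 hcomm hskew hT hs⟩

/-- **`𝔤 = 𝔰𝔭_E(V, ψ)`, rational form**: a rational `X` lies in `𝔤` iff it commutes with every Hodge endomorphism and is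
`ψ`-skew (descent `X ∈ 𝔤 ↔ X_ℂ ∈ 𝔤_ℂ`). [cite: MoonenZarhin1995Duke, Type I(2)] [cite: Deligne1982HodgeCycles, I §3 Prop. 3.4] -/
theorem SpBlocksTheta.mem_iff_commute_and_skew [Fintype ι] (H : HodgeStructure V n) (hn : n = 1) (heff : H.IsEffective)
    (ψ : H.Polarization)
    (hself : ∀ a : H.endAlg, LinearMap.IsAdjointPair ψ.form ψ.form (a : Module.End ℚ V) (a : Module.End ℚ V))
    (σ : ι → (H.endAlg →+* ℂ)) (hreal : ∀ i, (starRingEnd ℂ).comp (σ i) = σ i)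
    (hint : DirectSum.IsInternal fun i => H.eigenBlock (σ i)) (h4 : ∀ i, Module.finrank ℂ (H.eigenBlock (σ i)) = 4)
    (𝔤 : Submodule ℚ (Module.End ℚ V)) (hbr : ∀ X ∈ 𝔤, ∀ X' ∈ 𝔤, X * X' - X' * X ∈ 𝔤) {Θ : Module.End ℂ (ℂ ⊗[ℚ] V)}
    (hΘ : ∀ p, ∀ x ∈ H.piece p (n - p), Θ x = ((2 * p - n : ℤ) : ℂ) • x) (hΘ𝔤 : Θ ∈ spanC 𝔤)
    (hcomm : ∀ X ∈ 𝔤, ∀ a : H.endAlg, X * (a : Module.End ℚ V) = (a : Module.End ℚ V) * X)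
    (hskew : ∀ X ∈ 𝔤, ∀ v w, ψ.form (X v) w + ψ.form v (X w) = 0) (X : Module.End ℚ V) :
    X ∈ 𝔤 ↔
      (∀ a : H.endAlg, X * (a : Module.End ℚ V) = (a : Module.End ℚ V) * X) ∧
      (∀ v w, ψ.form (X v) w + ψ.form v (X w) = 0) := by
  refine ⟨fun hX => ⟨hcomm X hX, hskew X hX⟩, fun ⟨hc, hs⟩ => ?_⟩
  rw [mem_iff_baseChange_mem_spanC]
  exact SpBlocksTheta.mem_spanC_of_mapsTo_of_skew H hn heff ψ hself σ hreal hint h4 𝔤 hbr hΘ hΘ𝔤 hcomm hskew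
    (fun i => ThetaSubalgebra.mapsTo_baseChange_of_commute H σ hc i)
    (ThetaSubalgebra.formBaseChange_add_eq_zero_of_skew ψ hs)

/-- **UNIQUENESS: `𝔤 = Lie Hg(H)`** — the Lie algebra of the Hodge group is the ONLY rational bracket-closed subspace of
`𝔰𝔭_E(V, ψ)` whose complexification contains the Hodge operator, in the four-dimensional real-block situation (both are
`𝔰𝔭_E(V, ψ)`: `Lie Hg` itself is admissible — it commutes with `E`, is `ψ`-skew and `Θ ∈ Lie Hg ⊗ ℂ`). Deligne's minimality
principle (LNM 900 I Prop. 3.4: `MT` is the smallest `ℚ`-group whose complex points contain `μ(𝔾_m)`) in Lie form; for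
`H = H¹(X)`, `End⁰X = F` totally real with `dim X = 2[F:ℚ]`: «`Hg(X) = R_{F/ℚ} Sp_{4,F}`» (Moonen–Zarhin 1995 Type I(2)).
[cite: Deligne1982HodgeCycles, I §3 Prop. 3.4] [cite: MoonenZarhin1995Duke, Type I(2)] -/
theorem SpBlocksTheta.eq_hodgeLie [Fintype ι] (H : HodgeStructure V n) (hn : n = 1) (heff : H.IsEffective)
    (ψ : H.Polarization)
    (hself : ∀ a : H.endAlg, LinearMap.IsAdjointPair ψ.form ψ.form (a : Module.End ℚ V) (a : Module.End ℚ V))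
    (σ : ι → (H.endAlg →+* ℂ)) (hreal : ∀ i, (starRingEnd ℂ).comp (σ i) = σ i)
    (hint : DirectSum.IsInternal fun i => H.eigenBlock (σ i)) (h4 : ∀ i, Module.finrank ℂ (H.eigenBlock (σ i)) = 4)
    (𝔤 : Submodule ℚ (Module.End ℚ V)) (hbr : ∀ X ∈ 𝔤, ∀ X' ∈ 𝔤, X * X' - X' * X ∈ 𝔤) {Θ : Module.End ℂ (ℂ ⊗[ℚ] V)}
    (hΘ : ∀ p, ∀ x ∈ H.piece p (n - p), Θ x = ((2 * p - n : ℤ) : ℂ) • x) (hΘ𝔤 : Θ ∈ spanC 𝔤)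
    (hcomm : ∀ X ∈ 𝔤, ∀ a : H.endAlg, X * (a : Module.End ℚ V) = (a : Module.End ℚ V) * X)
    (hskew : ∀ X ∈ 𝔤, ∀ v w, ψ.form (X v) w + ψ.form v (X w) = 0) : 𝔤 = H.hodgeLie := by
  have hΘh : Θ ∈ spanC H.hodgeLie := by
    rw [← hodgeLieC_eq_spanC]
    exact H.mem_hodgeLieC_of_forall_piece hΘ
  ext X
  rw [SpBlocksTheta.mem_iff_commute_and_skew H hn heff ψ hself σ hreal hint h4 𝔤 hbr hΘ hΘ𝔤 hcomm hskew,
    SpBlocksTheta.mem_iff_commute_and_skew H hn heff ψ hself σ hreal hint h4 H.hodgeLie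
      (fun X hX X' hX' => H.commutator_mem_hodgeLie hX hX') hΘ hΘh (fun X hX a => H.commute_of_mem_hodgeLie hX a)
      (fun X hX v w => form_apply_add_eq_zero_of_mem_hodgeLie ψ hX v w)]

/-- **`𝔤_ℂ = Lie Hg(H) ⊗ ℂ`.** [cite: Deligne1982HodgeCycles, I §3 Prop. 3.4] [cite: MoonenZarhin1995Duke, Type I(2)] -/
theorem SpBlocksTheta.spanC_eq_hodgeLieC [Fintype ι] (H : HodgeStructure V n) (hn : n = 1) (heff : H.IsEffective)
    (ψ : H.Polarization)
    (hself : ∀ a : H.endAlg, LinearMap.IsAdjointPair ψ.form ψ.form (a : Module.End ℚ V) (a : Module.End ℚ V))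
    (σ : ι → (H.endAlg →+* ℂ)) (hreal : ∀ i, (starRingEnd ℂ).comp (σ i) = σ i)
    (hint : DirectSum.IsInternal fun i => H.eigenBlock (σ i)) (h4 : ∀ i, Module.finrank ℂ (H.eigenBlock (σ i)) = 4)
    (𝔤 : Submodule ℚ (Module.End ℚ V)) (hbr : ∀ X ∈ 𝔤, ∀ X' ∈ 𝔤, X * X' - X' * X ∈ 𝔤) {Θ : Module.End ℂ (ℂ ⊗[ℚ] V)}
    (hΘ : ∀ p, ∀ x ∈ H.piece p (n - p), Θ x = ((2 * p - n : ℤ) : ℂ) • x) (hΘ𝔤 : Θ ∈ spanC 𝔤)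
    (hcomm : ∀ X ∈ 𝔤, ∀ a : H.endAlg, X * (a : Module.End ℚ V) = (a : Module.End ℚ V) * X)
    (hskew : ∀ X ∈ 𝔤, ∀ v w, ψ.form (X v) w + ψ.form v (X w) = 0) : spanC 𝔤 = H.hodgeLieC := by
  rw [SpBlocksTheta.eq_hodgeLie H hn heff ψ hself σ hreal hint h4 𝔤 hbr hΘ hΘ𝔤 hcomm hskew, hodgeLieC_eq_spanC]

/-- **`Lie Hg(H) ⊗ ℂ = 𝔰𝔭_E(V, ψ)_ℂ = ⊕_i 𝔰𝔭(T_i)`** (the equality form of the tree's `SymplecticBlocks.exists_mem_hodgeLieC_supported`,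
S4): `Y ∈ Lie Hg ⊗ ℂ` iff `Y` preserves every block and is `ψ_ℂ`-skew; and the rational form `Lie Hg(H) = 𝔰𝔭_E(V, ψ)`.
Moonen–Zarhin 1995 Type I(2) «`Hg(X) = R_{F/ℚ} Sp_F(V, ψ)`», 1999 Thm. 0.1 (4) «`Hg(X) = Sp_D(V,φ)`».
[cite: MoonenZarhin1995Duke, Type I(2)] [cite: MoonenZarhin1999LowDim, §3 (3.1) and Lemma (3.4)] -/
theorem SpBlocksTheta.mem_hodgeLieC_iff_mapsTo_and_skew [Fintype ι] (H : HodgeStructure V n) (hn : n = 1)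
    (heff : H.IsEffective) (ψ : H.Polarization)
    (hself : ∀ a : H.endAlg, LinearMap.IsAdjointPair ψ.form ψ.form (a : Module.End ℚ V) (a : Module.End ℚ V))
    (σ : ι → (H.endAlg →+* ℂ)) (hreal : ∀ i, (starRingEnd ℂ).comp (σ i) = σ i)
    (hint : DirectSum.IsInternal fun i => H.eigenBlock (σ i)) (h4 : ∀ i, Module.finrank ℂ (H.eigenBlock (σ i)) = 4)
    (Y : Module.End ℂ (ℂ ⊗[ℚ] V)) :
    Y ∈ H.hodgeLieC ↔
      (∀ i, Set.MapsTo Y (H.eigenBlock (σ i)) (H.eigenBlock (σ i))) ∧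
      (∀ x y, ψ.form.baseChange ℂ (Y x) y + ψ.form.baseChange ℂ x (Y y) = 0) := by
  obtain ⟨Θ, hΘ⟩ := exists_hodgeTheta H
  have hΘh : Θ ∈ spanC H.hodgeLie := by
    rw [← hodgeLieC_eq_spanC]
    exact H.mem_hodgeLieC_of_forall_piece hΘ
  rw [hodgeLieC_eq_spanC]
  exact SpBlocksTheta.mem_spanC_iff_mapsTo_and_skew H hn heff ψ hself σ hreal hint h4 H.hodgeLie
    (fun X hX X' hX' => H.commutator_mem_hodgeLie hX hX') hΘ hΘh (fun X hX a => H.commute_of_mem_hodgeLie hX a)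
    (fun X hX v w => form_apply_add_eq_zero_of_mem_hodgeLie ψ hX v w) Y

/-- **`Lie Hg(H) = 𝔰𝔭_E(V, ψ)`, rational form** (four-dimensional real blocks): `X ∈ Lie Hg(H)` iff `X` commutes with `E` and
is `ψ`-skew. [cite: MoonenZarhin1995Duke, Type I(2)] [cite: MoonenZarhin1999LowDim, Thm. 0.1 (4)] -/
theorem SpBlocksTheta.mem_hodgeLie_iff_commute_and_skew [Fintype ι] (H : HodgeStructure V n) (hn : n = 1)
    (heff : H.IsEffective) (ψ : H.Polarization)
    (hself : ∀ a : H.endAlg, LinearMap.IsAdjointPair ψ.form ψ.form (a : Module.End ℚ V) (a : Module.End ℚ V))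
    (σ : ι → (H.endAlg →+* ℂ)) (hreal : ∀ i, (starRingEnd ℂ).comp (σ i) = σ i)
    (hint : DirectSum.IsInternal fun i => H.eigenBlock (σ i)) (h4 : ∀ i, Module.finrank ℂ (H.eigenBlock (σ i)) = 4)
    (X : Module.End ℚ V) :
    X ∈ H.hodgeLie ↔
      (∀ a : H.endAlg, X * (a : Module.End ℚ V) = (a : Module.End ℚ V) * X) ∧
      (∀ v w, ψ.form (X v) w + ψ.form v (X w) = 0) := by
  obtain ⟨Θ, hΘ⟩ := exists_hodgeTheta H
  have hΘh : Θ ∈ spanC H.hodgeLie := by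
    rw [← hodgeLieC_eq_spanC]
    exact H.mem_hodgeLieC_of_forall_piece hΘ
  exact SpBlocksTheta.mem_iff_commute_and_skew H hn heff ψ hself σ hreal hint h4 H.hodgeLie
    (fun X hX X' hX' => H.commutator_mem_hodgeLie hX hX') hΘ hΘh (fun X hX a => H.commute_of_mem_hodgeLie hX a)
    (fun X hX v w => form_apply_add_eq_zero_of_mem_hodgeLie ψ hX v w) X

section AnnLie

open Literature.RepresentationTheory.GeneralLinear Literature.NumberTheory.DiophantineGeometry

/-- **Theorem L (invariance of rational tensors under `𝔰𝔭_E(V, ψ)_ℂ = ⊕_i 𝔰𝔭(T_i)`, four-dimensional real blocks).** Let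
`H` be effective polarized of weight one with `E = End_Hdg(V)` `ψ`-self-adjoint and `V_ℂ = ⊕_i T_i` an internal
decomposition into FOUR-dimensional eigenblocks of real characters of `E` (the `H¹` of an abelian variety `X` with
`End⁰X` a totally real field of degree `dim X / 2`). Let `q` be a RATIONAL coefficient tensor (letters: slots `Fin m` × a
`ℚ`-basis `eQ` of `V`) killed — slice by slice, diagonally — by the matrix of the Hodge operator `Θ`. Then `q` is killed by
the matrix of EVERY block-preserving `ψ_ℂ`-skew operator `Y`. Proof: the rational Lie algebra `𝔞 ⊆ 𝔰𝔭_E(V, ψ)` of `q`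
(`annLie`) is bracket-closed with `Θ ∈ 𝔞_ℂ` by descent (`mem_spanC_annLie`), i.e. admissible, so `Y ∈ 𝔞_ℂ` (§5) and `𝔞_ℂ`
kills `q_ℂ`. The Lie step of «`B•(Xⁿ) = D•(Xⁿ)`» for such `X` (Moonen–Zarhin 1999 Thm. 0.1 (4) at type I(2): «`Hg(X) =
Sp_D(V,φ)` and `B•(Xⁿ) = D•(Xⁿ)` for all `n`», through the invariants of `∏_i Sp(T_i)`; the two-dimensional-block case is
the tree's `wordDerAt_eq_zero_of_mapsTo_of_skew`). [cite: MoonenZarhin1999LowDim, §3 (3.1) and Lemma (3.4)]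
[cite: Deligne1982HodgeCycles, I §3 Prop. 3.4] [cite: Hazama1983, §3 (pp. 305–306)] -/
theorem SpBlocksTheta.wordDerAt_eq_zero_of_mapsTo_of_skew [Fintype ι] {M d m : ℕ} (H : HodgeStructure V n) (hn : n = 1)
    (heff : H.IsEffective) (ψ : H.Polarization)
    (hself : ∀ a : H.endAlg, LinearMap.IsAdjointPair ψ.form ψ.form (a : Module.End ℚ V) (a : Module.End ℚ V))
    (σ : ι → (H.endAlg →+* ℂ)) (hreal : ∀ i, (starRingEnd ℂ).comp (σ i) = σ i)
    (hint : DirectSum.IsInternal fun i => H.eigenBlock (σ i)) (h4 : ∀ i, Module.finrank ℂ (H.eigenBlock (σ i)) = 4)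
    (eQ : Module.Basis (Fin M) ℚ V) (q : (Fin d → Fin m × Fin M) → ℚ) {Θ : Module.End ℂ (ℂ ⊗[ℚ] V)}
    (hΘ : ∀ p, ∀ x ∈ H.piece p (n - p), Θ x = ((2 * p - n : ℤ) : ℂ) • x)
    (hΘq : ∀ u : Fin d → Fin m, wordDerAt ℂ (fun _ : Fin d =>
      LinearMap.toMatrix (Algebra.TensorProduct.basis ℂ eQ) (Algebra.TensorProduct.basis ℂ eQ) Θ)
      (wordSlice (fun w => algebraMap ℚ ℂ (q w)) u) = 0)
    {Y : Module.End ℂ (ℂ ⊗[ℚ] V)} (hYT : ∀ i, Set.MapsTo Y (H.eigenBlock (σ i)) (H.eigenBlock (σ i)))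
    (hYskew : ∀ x y, ψ.form.baseChange ℂ (Y x) y + ψ.form.baseChange ℂ x (Y y) = 0)
    (u : Fin d → Fin m) :
    wordDerAt ℂ (fun _ : Fin d =>
      LinearMap.toMatrix (Algebra.TensorProduct.basis ℂ eQ) (Algebra.TensorProduct.basis ℂ eQ) Y)
      (wordSlice (fun w => algebraMap ℚ ℂ (q w)) u) = 0 := by
  -- the rational Lie algebra `𝔞 ⊆ 𝔰𝔭_E(V, ψ)` of `q`, with `E = End_Hdg(V)` itself as commuting family
  set 𝔞 : Submodule ℚ (Module.End ℚ V) := annLie ψ.form eQ (fun a : H.endAlg => (a : Module.End ℚ V)) q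
    with h𝔞
  have hΘC : Θ ∈ H.hodgeLieC := H.mem_hodgeLieC_of_forall_piece hΘ
  have hΘ𝔞 : Θ ∈ spanC 𝔞 :=
    mem_spanC_annLie ψ.form eQ _ q hΘq (fun a => commute_baseChange_of_mem_hodgeLieC H hΘC a)
      fun x y => by rw [formBaseChange_skew_of_mem_hodgeLieC ψ hΘC, neg_add_cancel]
  have hbr : ∀ X ∈ 𝔞, ∀ X' ∈ 𝔞, X * X' - X' * X ∈ 𝔞 := fun X hX X' hX' =>
    commutator_mem_annLie ψ.form eQ _ q hX hX'
  have hcomm : ∀ X ∈ 𝔞, ∀ a : H.endAlg, X * (a : Module.End ℚ V) = (a : Module.End ℚ V) * X :=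
    fun X hX a => ((mem_annLie_iff ψ.form eQ _ q X).1 hX).2.1 a
  have hskew : ∀ X ∈ 𝔞, ∀ v w, ψ.form (X v) w + ψ.form v (X w) = 0 :=
    fun X hX => ((mem_annLie_iff ψ.form eQ _ q X).1 hX).2.2
  have hY : Y ∈ spanC 𝔞 :=
    SpBlocksTheta.mem_spanC_of_mapsTo_of_skew H hn heff ψ hself σ hreal hint h4 𝔞 hbr hΘ hΘ𝔞 hcomm hskew hYT hYskew
  rw [h𝔞] at hY
  exact wordDerAt_eq_zero_of_mem_spanC_annLie ψ.form eQ _ q hY u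

end AnnLie

end HodgeStructure

end Literature.AlgebraicGeometry.Motives

end
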